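import Summits.KontsevichZagierPeriods.KontsevichZagierPeriods.Theses.TerasomaMultiplication
import Literature.NumberTheory.Transcendental.KZKernelConjectureForms
import Literature.Barriers.KontsevichZagierPeriods.PeriodEqualityDecidability
import Literature.NumberTheory.Transcendental.SemialgebraicLineDeriv
import Literature.NumberTheory.Transcendental.GammaMonomialsProofs
import Literature.NumberTheory.Transcendental.KZProduct
import Summits.KontsevichZagierPeriods.KontsevichZagierPeriods.Theses.CompiledSubstitutions
import Literature.NumberTheory.Transcendental.KontsevichZagierGammaProofs
import Literature.NumberTheory.Transcendental.KZSemialgebraicComplex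
import Literature.Analysis.SpecialFunctions.GammaMultiplication
import Summits.KontsevichZagierPeriods.KontsevichZagierPeriods.Theorems.BetaCancellation.Negative.KernelForm
import Summits.KontsevichZagierPeriods.KontsevichZagierPeriods.Theorems.BetaCancellation.Negative.PiLink
import Literature.NumberTheory.Transcendental.KZProductIdeal
import Literature.NumberTheory.Transcendental.KZMellinFibres
import Mathlib.MeasureTheory.Measure.Lebesgue.VolumeOfBalls
import Mathlib.MeasureTheory.Integral.Pi

/-!
# Disproof of `GammaHodgeSector` (stmt-KontsevichZagierPeriods-3742) — standing adversary, gen 1 (§0–§7) and gen 2 (cycle 2, §8–§11)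

**Verdict so far: the crux RESISTS — and it cannot be refuted without refuting the summit.**
(work file; findings indexed below, prose only in docstrings)

1. §1 `of_summit : KontsevichZagierPeriods → GammaHodgeSector` (two lines, from the tree's
   `kzPeriodConjecture'_iff_isRational`): every instance of the crux is an instance of the formal
   Kontsevich–Zagier conjecture (algebraic integrands are one Newton–Leibniz move from rational
   ones). Hence `¬ GammaHodgeSector → ¬ KontsevichZagierPeriods` (`summit_false_of_not`): a kill of
   this crux IS a kill of the summit as formalised; no evaluation kill is possible
   (`KZ.relations ≤ ker eval` is proved in the tree, and value equality is a HYPOTHESIS here).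
2. §2 LOAD-BEARING: `r.value = r'.value` is the only load-bearing hypothesis
   (`gammaHodgeSector_false_without_valueEq`, dimension-0 witness `c = 2`: `[pt, 1] ≁ [pt, 2]`).
   Every other hypothesis (admissibility, the Hodge-type test, `IsAlgebraic ℚ c`, the pinning of
   the two representations) may be dropped and the statement stays summit-implied
   (`core_of_summit` = `KZPeriodConjecture'`): they only carve out a SECTOR.
3. §3 ARITHMETIC OF THE HODGE TEST (comparing `u = 1` with `u = 2D − 1 ≡ −1`):
   `N + I = N' + I' + 2k` where `I = #{j | x_j + y_j ∈ ℤ}` (`hodge_weight_balance`); corollaries: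
   `N = 0 ⇒ N' = 0 ∧ k = 0` (the only dimension-0 instances are `[pt,1] ~ [pt,1]`, TRUE outright:
   `gammaHodgeSector_dim_zero`), `N = 1, N' = 0 ⇒ k = 1 ∧ x₀ + y₀ ∈ ℤ` (reflection–translation
   sector), `N = N' = 1 ⇒ k = 0` (linear sector), and with no integer sums
   `dim r = N = 2k + N' = dim r'`.
4. §4 `IsAlgebraic ℚ c` IS DECORATION: it follows from the pinning of `r'` alone
   (`isAlgebraic_of_isBallCubeRep`: a `ℚ`-semialgebraic function takes algebraic values at rational
   points — `isAlgebraic_apply_ratCast`, via a rational-coefficient clopen decomposition of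
   semialgebraic subsets of `ℝ¹`, `exists_clopen_off_zeros`, no Tarski–Seidenberg); hence
   `gammaHodgeSector_iff_without_isAlgebraic`. (So the only possible source of VACUITY of an
   instance is the pair Hodge-test/value-equality: `r.value = r'.value` is satisfiable iff `c` is
   the Deligne–Koblitz–Ogus constant, which the tree PROVES algebraic:
   `deligne_gammaMonomial_algebraic_holds`.)
5. §5 NON-VACUITY, CERTIFIED: the hypotheses hold simultaneously for the non-degenerate instance
   `(N,N',k) = (1,0,1)`, `x = y = ½`, `c = 1`, `r = arcsineRep = [(0,1), t^{−1/2}(1−t)^{−1/2}]`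
   (value `B(½,½) = π`), `r' = discRep = [open unit disc, 1]` (value `π`) —
   `calibration_hypotheses` (all seven conjuncts, sorry-free); so the crux asserts in particular
   `arcsineRep ~ discRep` (`calibration_of_gammaHodgeSector`), which after `t = (1+x)/2` is
   Kontsevich–Zagier's OWN §1.1 example `∫_{−1}^{1} dx/√(1−x²) = π` — the natural first prover
   target (4–5 moves), not claimed here. It is moreover the instance `a = ½` of item
   stmt-KontsevichZagierPeriods-3383 `EulerReflectionRational` (route CompiledSubstitutions):
   `calibration_of_eulerReflectionRational : EulerReflectionRational → arcsineRep ~ discRep`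
   (via `equivalent_piRep_discRep : [closed disc, 1] ~ [open disc, 1]`, one domain-additivity move
   along the null circle — `volume_unitCircle`, `of_circleRep_mem_relations`); the whole slice
   `N = 1, N' = 0, x + y = 1` of the sector is 3383 scaled by the algebraic constant `1/sin(πx)`.
6. §6 A REFUTED STRENGTHENING: the existential form of the sector with the Hodge test required
   ONLY AT `u = 1` is FALSE (`not_gammaHodgeSectorExistsAtOne`): `x = y = ¼`, `N' = 0` passes the
   `u = 1` test with `k = 0`, and `[(0,1), t^{−3/4}(1−t)^{−3/4}] ~ [pt, c]` would make
   `B(¼,¼) = Γ(¼)²/√π` algebraic (`c` algebraic by §4), against Chudnovsky's algebraic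
   independence of `π` and `Γ(¼)` — PROVED in the tree (`algebraicIndependent_real_pi_gamma_one_
   quarter`; standard axioms only). With the full test the same existential form is crux +
   Koblitz–Ogus, summit-implied. So the unit quantifier is essential and the data `(¼,¼)` lie
   outside the sector (`quarter_not_hodgeCondition`).
7. §7 TOOLS AND A POSITIVE CONSEQUENCE (evidence for provers, not landed by the refuter):
   `hodgeCondition_iff_le` — the test is periodic modulo any common multiple `D` of the
   denominators, so it reduces to `u ∈ [1, D]` and concrete data are settled by `decide +kernel`
   (`hodgeCondition_trip`); and `triplicationAccessible_of_gammaHodgeSector :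
   GammaHodgeSector → TriplicationAccessible` (stmt-KontsevichZagierPeriods-0312, shared by seven
   routes): the crux at `(2, 0, 1)`, `x = (1/9, 5/9)`, `y = (4/9, 7/9)`, `c = 2·3^{7/6}`
   (value equality = Gauss triplication, `beta_trip`, from the tree's
   `GaussMultiplication.real_formula`; Fubini `value_trip_cube`) plus ONE scaling move
   `equivalent_constDisc_radiusTwo` (`z ↦ 2z`, `|det| = 4`). So "the sector contains the
   triplication pair" is now a theorem, standard axioms. The two "deep" instances proposed as
   disprover targets by triage r1 (`DasDeepThirtyThree`, `DasDeepThirtyFive` in SketchIdeator3)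
   are certified IN the sector (`hodgeCondition_deep33/35`, `decide +kernel` at `D = 33, 35`)
   and, being typed with value equality as a hypothesis, are summit-implied like the crux: no kill
   short of `¬` summit there either. Likewise `dasGapTwelve_of_gammaHodgeSector' :
   GammaHodgeSector → DasGapTwelve` UNCONDITIONALLY (item 13215 = the sector's instance `(1,1,0)`,
   `x = 1/12, y = 1/4, x' = y' = 1/4`, `c = c₀ = 2^{−1/4}3^{3/8}√(1+√3)`; Hodge test at `D = 12` by
   `decide +kernel`; the Chowla–Selberg/Vidunas value identity `B(1/12,1/4) = c₀·B(1/4,1/4)` is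
   PROVED here — `beta_das`, via `gamma_one_twelfth_sq : Γ(1/12)²·π·3^{1/4} = 6 sin(5π/12)
   Γ(1/4)²Γ(1/3)²` from the tree's Gauss multiplication at `n = 2, 3` and Mathlib's reflection, by
   polynomial elimination; no extra move).
8. WHY IT RESISTS, in one paragraph. Every instance is a pair of representations with EQUAL
   values by hypothesis, so the only conceivable kill is an additive invariant of `FormalRep`
   vanishing on the four move sets and finer than `eval` (route Neg's programme); none is known,
   and exhibiting one on ANY pair refutes Conjecture 1 as formalised. Transcription errors in the
   Hodge test cannot produce false instances either (they only shrink or void the sector, §2/§4).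
   Small-model / decidable reductions do not apply (the conclusion is membership in a subgroup of
   a free abelian group on an uncountable type). Barrier catalogue
   (`Literature/Barriers/KontsevichZagierPeriods/`): the algebraic-primitives obstruction
   (`noSemialgebraicPrimitive_inv_sub_two`, `algebraicPrimitivesObstructionNarrow`, Ayoub
   Rem. 1.2, proved there for `1/(t−2)`) constrains HOW, not WHETHER — in the same spirit the
   primitive `2 arcsin √t` of the calibration integrand is transcendental, so no dimension-1
   Newton–Leibniz move integrates it out and the chain of §5 must pass through dimension 2 (the
   barrier's own "add variables" evasion); the GPC-dependence barriers
   (`GrothendieckPeriodConjectureDependence*`) are not engaged (every identity in this sector is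
   a theorem — Koblitz–Ogus is PROVED in the tree); `HauptvermutungObstruction` is not engaged (no
   global semialgebraic homeomorphism is sought); `PeriodEqualityDecidability` does not bite
   (equality inside the Γ-sector IS decidable — the Hodge test).
9. LANDED in the tree by gen 1 (importable; namespace `Summit.KontsevichZagierPeriods.GammaHodgeSectorNegative`;
   all ACCEPTED, standard axioms): `Theorems/GammaHodgeSector/Negative/LoadBearing.lean` (p73018: §0–§2),
   `HodgeTest.lean` (p74151: §3), `Algebraicity.lean` (p74153: §4), `Calibration.lean` (p74154:
   §5), `FiniteTest.lean` (p74543: §7 `hodgeCondition_iff_le`), `Strengthening.lean` (§6). The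
   positive glue of §7 (`triplicationAccessible_of_gammaHodgeSector`, `dasGapTwelve_of_gammaHodgeSector`)
   is attached as evidence to items 3742 / 0312 / 13215 for a prover to land.

GEN 2 (cycle 2, 2026-08-16; two skeletons were registered on the item meanwhile —
`line-koblitz-ogus-halving.lean` (stubs `stub_hodgeLattice`, `stub_betaSyzygy`, `stub_ballDisc`,
`stub_powerFromLattice`, `stub_positiveRoot`; 02:09Z) and `line-schwarz-cusp-transport.lean` (stubs
`stub_cuspRelation`, `stub_schwarzWitnesses`, `stub_cornerChains`, `stub_threeTermToPair`,
`stub_smoothLatticeGeneration`, `stub_latticeRealisation`, `stub_residualBeyondSchwarz`; 02:20Z, the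
currently ACTIVE registration). Their files are not readable on this box (crux write refused for the
planners, evidence store unmounted); the attacks below use the REGISTERED SIGNATURES verbatim where they
are library-typed and state the reading otherwise):

10. §8 TARGETS A (koblitz-ogus-halving). `stub_positiveRoot` (root extraction by positivity, verbatim
    `StubPositiveRoot`) is SUMMIT-IMPLIED (`stubPositiveRoot_of_summit`: soundness + `eval_mul'` +
    injectivity of `t ↦ t^{n+1}` + kernel form) — no kill short of `¬` summit — and already at `n = 0`
    it IS regular cancellation in `FormalRep ⧸ relations` (`regularCancellation_of_stubPositiveRoot`,
    the positivity guards are free: shift by `[pt, M]`), hence implies this route's OPEN crux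
    `BetaCancellation` (13633; `betaCancellation_of_stubPositiveRoot`, via `betaRep a b` and
    `kernelCancellation_of_regularCancellation`) and the OPEN `KZ.PiCancellation` (0540;
    `piCancellation_of_stubPositiveRoot`). Sandwich: `PiCancellation ∧ BetaCancellation ≤ stub ≤ summit`.
    Its own guards are load-bearing (`stubRoot_false_without_positivity`: `n = 1`, `x = [π]`,
    `y = −[π]`, `κ = [pt,1]`; `stubRoot_false_without_regular`: `κ = 0`).
    The other four stubs: `stub_betaSyzygy`, `stub_powerFromLattice` carry `r.value = r'.value` and
    conclude a relation of evaluation `0` ⇒ instances of the kernel form ⇒ summit-implied;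
    `stub_ballDisc` (`[B^{2k}×cube, c k! Π] − [π]^k [cube, cΠ] ∈ relations`) has both sides of value
    `c π^k Π B` (§11 `ballCubeRep_value`: `vol B^{2k} = π^k/k!`) ⇒ summit-implied; `stub_hodgeLattice`
    is the Koblitz–Ogus ℚ-span theorem, PROVED in the tree (`KoblitzOgus.hodge_eq_combination_int`) up
    to the skeleton's encoding (`KOCertificate`, `betaExp`, `DensDvd` unreadable here). No stub of this
    line is killable; its hardest stub is not cheaper than two open cruxes.
11. §9 TARGETS B (schwarz-cusp-transport). `stub_latticeRealisation`, `stub_residualBeyondSchwarz`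
    (conclusion `Equivalent r r'` under `r.value = r'.value`) are crux-shaped ⇒ summit-implied
    (`core_of_summit`), not killable; `stub_residualBeyondSchwarz` is literally the crux restricted to
    data with a prime `p > 5` in a denominator — the line's honest remainder (levels 21, 28, 33, 35, …:
    depth-4 instances `hodgeCondition_deep33/35` of §7 lie there). `stub_cuspRelation` concludes
    `[s₁] + [s₂] + [s₃] ∈ relations`; by soundness this needs the VALUE identity
    `(1−c)B(a,c−a) + e·B_c·B(a,e) + b·A·B(c−a,1−e) = 0`, which with Kummer's
    `A = Γ(2−c)Γ(e)/(Γ(1−a)Γ(1−b))`, `B_c = Γ(2−c)Γ(−e)/(Γ(a−c+1)Γ(b−c+1))` reduces to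
    `sin πc · sin πe = sin π(c−a) · sin π(c−b) − sin πa · sin πb`, PROVED here for all real `a, b, c`
    (`cusp_trig_identity`) — so the stub is summit-implied PROVIDED `CuspDatum a b c` pins `d.A = A`,
    `d.B = B_c` (if the structure leaves them free, the stub is false by soundness: lead, check the
    fields); `stub_threeTermToPair` is formal linear algebra in `FormalRep ⧸ relations` given
    `AccessiblePair`; `stub_cornerChains` asserts three linear pairs from Multiplication + Reflection +
    BetaCancellation: Hodge type verified (`hodgeCondition_corner12` by `decide`), standard-span
    membership is a lattice question handed to the compute job; `stub_smoothLatticeGeneration` is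
    DECIDABLE ARITHMETIC per level — the one genuinely attackable stub: kit job (`compute/smooth_gap.gp`,
    job ids in §9) recomputes `H_D/S_D` for every 5-smooth `D` beyond the planner's bound 360 and tests
    generation by the three Schwarz classes (level-lifted; and with unit twists); results in §9.
12. §10 THE FIRST INSTANCE IS NOW A THEOREM: `equivalent_arcsineRep_discRep` (unconditional, composing
    congruence with the BetaCancellation disprover's landed four-move chain `[β(½,½)] ∼ [π]` and §5's
    null-circle move) and `gammaHodgeSector_instance_half`: the instance `(1,0,1), x = y = ½` of the crux
    HOLDS for every `c, r, r'` (value equality forces `c = 1`). Tightness at the bottom rung: no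
    refutation can live there.
13. §11 CANONICAL FORM AND THE EXACT NON-VACUITY CRITERION: explicit `cubeRep x y`,
    `ballRep k C` (`vol B^{2k} = π^k/k!`, `volume_unitBall_even`), `ballCubeRep = ballRep × cubeRep'`
    (`KZ.IntegralRep.prod`); value formulas `value_of_isCubeBetaRep = Π B(x_j,y_j)`,
    `value_of_isBallCubeRep = c·π^k·Π B(x'_l,y'_l)` (any pinned `r, r'`); hence
    `exists_pinned_valueEq_iff`: an instance is NON-VACUOUS iff `c` is algebraic AND the Deligne identity
    `Π B(x,y) = c π^k Π B(x',y')` holds (`DeligneIdentity`), and `gammaHodgeSector_iff_canonical`: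
    the crux ⟺ ∀ admissible Hodge data, ∀ algebraic `c` with the Deligne identity,
    `cubeRep x y ∼ [B^{2k}, c·k!] × cubeRep x' y'`. The `∀ r r'` and the value hypothesis are pure
    packaging; the "ball–disc" normalisation every line must do is confined to the factor `[B^{2k}, c·k!]`.
14. WHY IT STILL RESISTS: unchanged (item 8) — every non-vacuous instance is a Deligne pair of EQUAL
    value; a kill is an additive invariant of `FormalRep` finer than `eval` on one such pair = `¬` summit.
    New refuted strengthenings beyond §6: none found refutable with the tree's transcendence facts (the
    `u ≡ ±1`-only test: exhaustive search at levels 8 and 12 with ≤ 2 Beta factors a side finds no datum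
    whose Γ-ratio avoids the jointly-unknown pair `(Γ(1/3), Γ(1/4))` resp. `Γ(1/8)`; recorded, not
    pursued). LANDING (gen 2): `Negative/StubPositiveRoot.lean`, `Negative/FirstInstance.lean`,
    `Negative/Canonical.lean` proposed `--supports` 3742 (ids in NOTES / item evidence).
-/

noncomputable section

set_option linter.dupNamespace false

open MeasureTheory Set
open scoped BigOperators

namespace Summit.KontsevichZagierPeriods.KontsevichZagierPeriods.Cruxes.GammaHodgeSector.Disproof

open Literature.NumberTheory.Transcendental
open Literature.NumberTheory.Transcendental.KZ
open Literature.ModelTheory.ExponentialFields (IsSemialgebraic isSemialgebraic_univ)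
open Literature.Barriers.KontsevichZagierPeriods.KZ (constRep constRep_value)
open Summit.KontsevichZagierPeriods.KontsevichZagierPeriods.Theses.TerasomaMultiplication (GammaHodgeSector)

/-! ## §0 Vocabulary and unfolding -/

/-- Admissible exponent data of the crux: positive, non-integer rationals. [folklore] -/
def Admissible {N : ℕ} (x y : Fin N → ℚ) : Prop :=
  ∀ j, 0 < x j ∧ 0 < y j ∧ Int.fract (x j) ≠ 0 ∧ Int.fract (y j) ≠ 0

/-- `u` is coprime to every denominator of the data. [folklore] -/
def CoprimeDen {N : ℕ} (x y : Fin N → ℚ) (u : ℕ) : Prop :=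
  ∀ j, Nat.Coprime u (x j).den ∧ Nat.Coprime u (y j).den

/-- The Koblitz–Ogus sum `Σ_j ({u x_j} + {u y_j} − {u (x_j + y_j)})` of the crux at the unit `u`.
[cite: Deligne1982HodgeCycles, §7 (restatement before Thm. 7.18)] -/
def hodgeSum {N : ℕ} (x y : Fin N → ℚ) (u : ℕ) : ℚ :=
  ∑ j, (Int.fract ((u : ℚ) * x j) + Int.fract ((u : ℚ) * y j) - Int.fract ((u : ℚ) * (x j + y j)))

/-- The Hodge-type condition of the crux (verbatim): for every `u ≥ 1` coprime to all
denominators, `hodgeSum x y u − hodgeSum x' y' u = k`. [cite: Deligne1982HodgeCycles, Thm. 7.18] -/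
def HodgeCondition (N N' k : ℕ) (x y : Fin N → ℚ) (x' y' : Fin N' → ℚ) : Prop :=
  ∀ u : ℕ, 0 < u → CoprimeDen x y u → CoprimeDen x' y' u → hodgeSum x y u - hodgeSum x' y' u = (k : ℚ)

/-- `r` is pinned as the cube representation `[(0,1)^N, Π t_j^{x_j−1}(1−t_j)^{y_j−1}]`. [folklore] -/
def IsCubeBetaRep {N : ℕ} (x y : Fin N → ℚ) (r : IntegralRep N) : Prop :=
  r.domain = {t | ∀ j, t j ∈ Ioo (0:ℝ) 1} ∧
    EqOn r.integrand (fun t => ∏ j, (t j) ^ ((x j : ℝ) - 1) * (1 - t j) ^ ((y j : ℝ) - 1)) r.domain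

/-- `r'` is pinned as the representation `[unit 2k-ball × (0,1)^{N'}, c · k! · Π (…)]`. [folklore] -/
def IsBallCubeRep {N' : ℕ} (k : ℕ) (x' y' : Fin N' → ℚ) (c : ℝ) (r' : IntegralRep (2 * k + N')) : Prop :=
  r'.domain = {z | (∑ i : Fin (2 * k), (z (Fin.castAdd N' i)) ^ 2) < 1 ∧
      ∀ l : Fin N', z (Fin.natAdd (2 * k) l) ∈ Ioo (0:ℝ) 1} ∧
    EqOn r'.integrand (fun z => c * (k.factorial : ℝ) *
      ∏ l, (z (Fin.natAdd (2 * k) l)) ^ ((x' l : ℝ) - 1) * (1 - z (Fin.natAdd (2 * k) l)) ^ ((y' l : ℝ) - 1))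
      r'.domain

/-- The crux, unfolded into the vocabulary above (definitional). [folklore] -/
theorem gammaHodgeSector_iff :
    GammaHodgeSector ↔
      ∀ (N N' k : ℕ) (x y : Fin N → ℚ) (x' y' : Fin N' → ℚ) (c : ℝ),
        Admissible x y → Admissible x' y' → HodgeCondition N N' k x y x' y' → IsAlgebraic ℚ c →
        ∀ (r : IntegralRep N) (r' : IntegralRep (2 * k + N')),
          IsCubeBetaRep x y r → IsBallCubeRep k x' y' c r' → r.value = r'.value → Equivalent r r' := by
  constructor
  · intro h N N' k x y x' y' c hx hx' hH hc r r' hr hr' hv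
    exact h N N' k x y x' y' c hx hx' hH hc r r' hr.1 hr.2 hr'.1 hr'.2 hv
  · intro h N N' k x y x' y' c hx hx' hH hc r r' hd hi hd' hi' hv
    exact h N N' k x y x' y' c hx hx' hH hc r r' ⟨hd, hi⟩ ⟨hd', hi'⟩ hv

/-! ## §1 The crux resists: it is a sector of the summit -/

/-- The part of the crux that carries all its content: the two-representation form of the
period conjecture for ALL representations (`KZPeriodConjecture'`), which the summit implies
(`kzPeriodConjecture'_iff_isRational`, one Newton–Leibniz "graph" move per side).
[cite: KontsevichZagier2001, §1.2 Conjecture 1] -/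
theorem core_of_summit (h : KontsevichZagierPeriods) : KZPeriodConjecture' :=
  kzPeriodConjecture'_iff_isRational.mpr h

/-- **The summit implies the crux.** Every instance of `GammaHodgeSector` is an instance of the
formal Kontsevich–Zagier conjecture: the admissibility, Hodge-type, algebraicity and pinning
hypotheses are not used. [cite: KontsevichZagier2001, §1.2 Conjecture 1] -/
theorem of_summit (h : KontsevichZagierPeriods) : GammaHodgeSector := by
  intro N N' k x y x' y' c _ _ _ _ r r' _ _ _ _ hv
  exact core_of_summit h r r' hv

/-- Contrapositive: a refutation of this crux refutes the summit as formalised. [folklore] -/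
theorem summit_false_of_not (h : ¬ GammaHodgeSector) : ¬ KontsevichZagierPeriods :=
  fun hs => h (of_summit hs)

/-! ## §2 Load-bearing analysis: only value equality bears load -/

/-- The crux with the hypothesis `r.value = r'.value` DROPPED. [folklore] -/
def GammaHodgeSectorWithoutValueEq : Prop :=
  ∀ (N N' k : ℕ) (x y : Fin N → ℚ) (x' y' : Fin N' → ℚ) (c : ℝ),
    Admissible x y → Admissible x' y' → HodgeCondition N N' k x y x' y' → IsAlgebraic ℚ c →
    ∀ (r : IntegralRep N) (r' : IntegralRep (2 * k + N')),
      IsCubeBetaRep x y r → IsBallCubeRep k x' y' c r' → Equivalent r r'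

/-- The dimension-0 rational constant `[pt, q]` is pinned as the cube representation with no
variables (`N = 0`: domain `(0,1)^0 = {pt}`, empty product `= 1`) exactly when `q = 1`… here we
only need the direction used below: `constRep 1` is such a representation. [folklore] -/
theorem isCubeBetaRep_constRep_one : IsCubeBetaRep (N := 0) Fin.elim0 Fin.elim0 (constRep 1) := by
  refine ⟨?_, ?_⟩
  · ext t
    simp [constRep]
  · intro t _
    simp [constRep]

/-- `[pt, c]` (for rational `c`, as `constRep c`) is the ball × cube representation with
`k = 0`, `N' = 0` and constant `c`. [folklore] -/
theorem isBallCubeRep_constRep (q : ℚ) :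
    IsBallCubeRep (N' := 0) 0 Fin.elim0 Fin.elim0 (q : ℝ) (constRep q) := by
  refine ⟨?_, ?_⟩
  · ext t
    simp [constRep]
  · intro t _
    simp [constRep]

/-- The Hodge-type condition holds trivially for empty data with `k = 0`. [folklore] -/
theorem hodgeCondition_empty : HodgeCondition 0 0 0 Fin.elim0 Fin.elim0 Fin.elim0 Fin.elim0 := by
  intro u _ _ _
  simp [hodgeSum]

/-- Empty data are admissible. [folklore] -/
theorem admissible_elim0 : Admissible (N := 0) Fin.elim0 Fin.elim0 := fun j => j.elim0

/-- **Value equality is load-bearing.** Without `r.value = r'.value` the crux fails already in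
dimension `0`: data `N = N' = k = 0`, `c = 2` (algebraic), `r = [pt, 1]`, `r' = [pt, 2]` satisfy
every other hypothesis, and `r ≁ r'` by soundness of the calculus (`1 ≠ 2`). Any proof must use
the value hypothesis. [folklore] -/
theorem gammaHodgeSector_false_without_valueEq : ¬ GammaHodgeSectorWithoutValueEq := by
  intro h
  have halg : IsAlgebraic ℚ ((2 : ℚ) : ℝ) := isAlgebraic_algebraMap (2 : ℚ)
  have hE := h 0 0 0 Fin.elim0 Fin.elim0 Fin.elim0 Fin.elim0 ((2 : ℚ) : ℝ)
    admissible_elim0 admissible_elim0 hodgeCondition_empty halg (constRep 1) (constRep 2)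
    isCubeBetaRep_constRep_one (isBallCubeRep_constRep 2)
  have hval := Equivalent.value_eq_holds hE
  rw [constRep_value, constRep_value] at hval
  norm_num at hval

/-- For contrast: the crux with EVERY hypothesis except value equality dropped (and the two
representations no longer pinned) is still implied by the summit — it is `KZPeriodConjecture'`.
So admissibility, the Hodge-type test, `IsAlgebraic ℚ c` and the pinnings bear no load; they
select a sector. [cite: KontsevichZagier2001, §1.2 Conjecture 1] -/
theorem withoutEverythingButValueEq_of_summit (h : KontsevichZagierPeriods) :
    ∀ ⦃n m : ℕ⦄ (r : IntegralRep n) (r' : IntegralRep m), r.value = r'.value → Equivalent r r' :=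
  core_of_summit h


/-! ## §3 Arithmetic of the Hodge-type test: the weight balance `N + I = N' + I' + 2k` -/

/-- The number of indices with an INTEGER sum `x_j + y_j` (there `Γ(x_j + y_j)` is rational and
the pair contributes `{u x_j} + {u y_j} = 1` to the test for every unit `u`). [folklore] -/
def intSums {N : ℕ} (x y : Fin N → ℚ) : ℕ :=
  (Finset.univ.filter fun j => Int.fract (x j + y j) = 0).card

/-- `intSums ≤ N`. [folklore] -/
theorem intSums_le {N : ℕ} (x y : Fin N → ℚ) : intSums x y ≤ N := by
  unfold intSums
  exact (Finset.card_filter_le _ _).trans (by simp)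

/-- A common multiple of all denominators of the data (product of `den x_j · den y_j` and
`den x'_l · den y'_l`). [folklore] -/
def commonDen {N N' : ℕ} (x y : Fin N → ℚ) (x' y' : Fin N' → ℚ) : ℕ :=
  (∏ j, (x j).den * (y j).den) * ∏ l, (x' l).den * (y' l).den

/-- `commonDen` is positive. [folklore] -/
theorem commonDen_pos {N N' : ℕ} (x y : Fin N → ℚ) (x' y' : Fin N' → ℚ) :
    0 < commonDen x y x' y' :=
  Nat.mul_pos (Finset.prod_pos fun j _ => Nat.mul_pos (x j).den_pos (y j).den_pos)
    (Finset.prod_pos fun l _ => Nat.mul_pos (x' l).den_pos (y' l).den_pos)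

/-- `den x_j · den y_j ∣ commonDen`. [folklore] -/
theorem den_mul_den_dvd_commonDen {N N' : ℕ} (x y : Fin N → ℚ) (x' y' : Fin N' → ℚ) (j : Fin N) :
    (x j).den * (y j).den ∣ commonDen x y x' y' :=
  (Finset.dvd_prod_of_mem (fun j => (x j).den * (y j).den) (Finset.mem_univ j)).trans
    (dvd_mul_right _ _)

/-- `den x'_l · den y'_l ∣ commonDen`. [folklore] -/
theorem den_mul_den_dvd_commonDen' {N N' : ℕ} (x y : Fin N → ℚ) (x' y' : Fin N' → ℚ) (l : Fin N') :
    (x' l).den * (y' l).den ∣ commonDen x y x' y' :=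
  (Finset.dvd_prod_of_mem (fun l => (x' l).den * (y' l).den) (Finset.mem_univ l)).trans
    (dvd_mul_left _ _)

/-- `2D − 1` is coprime to every divisor of `D` (Bezout: `−(2D−1) + 2(D/m)·m = 1`). [folklore] -/
theorem coprime_two_mul_sub_one {D m : ℕ} (hD : 0 < D) (hm : m ∣ D) : Nat.Coprime (2 * D - 1) m := by
  rw [← Nat.isCoprime_iff_coprime]
  refine ⟨-1, 2 * ((D / m : ℕ) : ℤ), ?_⟩
  have h1 : ((2 * D - 1 : ℕ) : ℤ) = 2 * (D : ℤ) - 1 := by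
    have : 1 ≤ 2 * D := by omega
    push_cast [Nat.cast_sub this]
    ring
  have h2 : ((D / m : ℕ) : ℤ) * (m : ℤ) = D := by exact_mod_cast Nat.div_mul_cancel hm
  rw [h1]
  linear_combination 2 * h2

/-- Units `u ≡ −1 (mod D)`: `{(2D−1) q} = {−q}` whenever `den q ∣ D`. [folklore] -/
theorem fract_two_mul_sub_one_mul {D : ℕ} (hD : 0 < D) {q : ℚ} (hq : q.den ∣ D) :
    Int.fract (((2 * D - 1 : ℕ) : ℚ) * q) = Int.fract (-q) := by
  obtain ⟨e, he⟩ := hq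
  have hDq : (D : ℚ) * q = (e : ℚ) * (q.num : ℚ) := by
    have hnum : q * q.den = q.num := Rat.mul_den_eq_num q
    rw [he]
    push_cast
    linear_combination (e : ℚ) * hnum
  have hcast : ((2 * D - 1 : ℕ) : ℚ) = 2 * (D : ℚ) - 1 := by
    have : 1 ≤ 2 * D := by omega
    push_cast [Nat.cast_sub this]
    ring
  have : ((2 * D - 1 : ℕ) : ℚ) * q = ((2 * ((e : ℤ) * q.num) : ℤ) : ℚ) + (-q) := by
    rw [hcast]
    push_cast
    linear_combination (2 : ℚ) * hDq
  rw [this, Int.fract_intCast_add]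

/-- `{q} + {−q}` is `0` for integral `q` and `1` otherwise. [folklore] -/
theorem fract_add_fract_neg (q : ℚ) :
    Int.fract q + Int.fract (-q) = if Int.fract q = 0 then 0 else 1 := by
  split_ifs with h
  · rw [h, Int.fract_neg_eq_zero.mpr h, add_zero]
  · rw [Int.fract_neg h]; ring

/-- **The two test sums at `u = 1` and `u ≡ −1` add up to `N + I`.** For admissible data and `D`
a common multiple of the `den x_j · den y_j`:
`hodgeSum x y 1 + hodgeSum x y (2D−1) = N + #{j | x_j + y_j ∈ ℤ}`. [folklore] -/
theorem hodgeSum_one_add_hodgeSum_neg {N : ℕ} {x y : Fin N → ℚ} (hx : Admissible x y) {D : ℕ}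
    (hD : 0 < D) (hden : ∀ j, (x j).den * (y j).den ∣ D) :
    hodgeSum x y 1 + hodgeSum x y (2 * D - 1) = (N : ℚ) + intSums x y := by
  unfold hodgeSum intSums
  rw [← Finset.sum_add_distrib]
  have hterm : ∀ j, (Int.fract (((1 : ℕ) : ℚ) * x j) + Int.fract (((1 : ℕ) : ℚ) * y j) -
        Int.fract (((1 : ℕ) : ℚ) * (x j + y j))) +
      (Int.fract (((2 * D - 1 : ℕ) : ℚ) * x j) + Int.fract (((2 * D - 1 : ℕ) : ℚ) * y j) -
        Int.fract (((2 * D - 1 : ℕ) : ℚ) * (x j + y j))) =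
      1 + (if Int.fract (x j + y j) = 0 then 1 else 0) := by
    intro j
    obtain ⟨-, -, hxj, hyj⟩ := hx j
    have hdx : (x j).den ∣ D := (dvd_mul_right _ _).trans (hden j)
    have hdy : (y j).den ∣ D := (dvd_mul_left _ _).trans (hden j)
    have hdxy : (x j + y j).den ∣ D := (Rat.add_den_dvd (x j) (y j)).trans (hden j)
    simp only [Nat.cast_one, one_mul]
    rw [fract_two_mul_sub_one_mul hD hdx, fract_two_mul_sub_one_mul hD hdy,
      fract_two_mul_sub_one_mul hD hdxy, Int.fract_neg hxj, Int.fract_neg hyj]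
    have h := fract_add_fract_neg (x j + y j)
    split_ifs at h ⊢ with h0
    · linear_combination (-1 : ℚ) * h
    · linear_combination (-1 : ℚ) * h
  rw [Finset.sum_congr rfl fun j _ => hterm j, Finset.sum_add_distrib, Finset.sum_boole]
  simp

/-- **Weight balance.** The Hodge-type test forces `N + I = N' + I' + 2k`, where `I`, `I'`
count the integer sums (compare the units `u = 1` and `u = 2D − 1 ≡ −1 (mod D)`: their test sums
add up to `N + I` resp. `N' + I'`). In Deligne's language: the total mass `Σ n(b)` of the
Γ-monomial is `2c` (Koblitz–Ogus). [cite: KoblitzOgus1979, p. 343] -/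
theorem hodge_weight_balance {N N' k : ℕ} {x y : Fin N → ℚ} {x' y' : Fin N' → ℚ}
    (hx : Admissible x y) (hx' : Admissible x' y') (hH : HodgeCondition N N' k x y x' y') :
    N + intSums x y = N' + intSums x' y' + 2 * k := by
  set D := commonDen x y x' y' with hDdef
  have hD : 0 < D := commonDen_pos x y x' y'
  have h1 := hH 1 one_pos (fun j => ⟨Nat.coprime_one_left _, Nat.coprime_one_left _⟩)
    (fun l => ⟨Nat.coprime_one_left _, Nat.coprime_one_left _⟩)
  have hu := hH (2 * D - 1) (by omega)
    (fun j => ⟨coprime_two_mul_sub_one hD ((dvd_mul_right _ _).trans (den_mul_den_dvd_commonDen x y x' y' j)),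
      coprime_two_mul_sub_one hD ((dvd_mul_left _ _).trans (den_mul_den_dvd_commonDen x y x' y' j))⟩)
    (fun l => ⟨coprime_two_mul_sub_one hD ((dvd_mul_right _ _).trans (den_mul_den_dvd_commonDen' x y x' y' l)),
      coprime_two_mul_sub_one hD ((dvd_mul_left _ _).trans (den_mul_den_dvd_commonDen' x y x' y' l))⟩)
  have hs := hodgeSum_one_add_hodgeSum_neg hx hD (den_mul_den_dvd_commonDen x y x' y')
  have hs' := hodgeSum_one_add_hodgeSum_neg hx' hD (den_mul_den_dvd_commonDen' x y x' y')
  have key : ((N + intSums x y : ℕ) : ℚ) = ((N' + intSums x' y' + 2 * k : ℕ) : ℚ) := by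
    push_cast
    linear_combination h1 + hu - hs + hs'
  exact_mod_cast key

/-- Parity: `N + I ≡ N' + I' (mod 2)`. [folklore] -/
theorem hodge_parity {N N' k : ℕ} {x y : Fin N → ℚ} {x' y' : Fin N' → ℚ}
    (hx : Admissible x y) (hx' : Admissible x' y') (hH : HodgeCondition N N' k x y x' y') :
    (N + intSums x y) % 2 = (N' + intSums x' y') % 2 := by
  have := hodge_weight_balance hx hx' hH
  omega

/-- With no integer sums on either side the two representations have the SAME dimension:
`dim r = N = 2k + N' = dim r'`. [folklore] -/
theorem dim_eq_of_no_intSums {N N' k : ℕ} {x y : Fin N → ℚ} {x' y' : Fin N' → ℚ}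
    (hx : Admissible x y) (hx' : Admissible x' y') (hH : HodgeCondition N N' k x y x' y')
    (h0 : intSums x y = 0) (h0' : intSums x' y' = 0) : N = 2 * k + N' := by
  have := hodge_weight_balance hx hx' hH
  omega

/-- `k ≤ N`: at most `N` powers of `π` (`I ≤ N`). [folklore] -/
theorem k_le {N N' k : ℕ} {x y : Fin N → ℚ} {x' y' : Fin N' → ℚ}
    (hx : Admissible x y) (hx' : Admissible x' y') (hH : HodgeCondition N N' k x y x' y') :
    k ≤ N := by
  have := hodge_weight_balance hx hx' hH
  have := intSums_le x y
  omega

/-- **Degenerate corner `N = 0`.** The test then forces `N' = 0` and `k = 0`. [folklore] -/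
theorem eq_zero_of_N_eq_zero {N' k : ℕ} {x y : Fin 0 → ℚ} {x' y' : Fin N' → ℚ}
    (hx' : Admissible x' y') (hH : HodgeCondition 0 N' k x y x' y') : N' = 0 ∧ k = 0 := by
  have h := hodge_weight_balance (fun j => j.elim0) hx' hH
  have h0 : intSums x y = 0 := by simp [intSums]
  omega

/-- The value of a dimension-0 representation with full domain is its integrand at the point
(`vol ℝ⁰ = 1`). [cite: KontsevichZagier2001, §1.1] -/
theorem value_dim_zero (ρ : IntegralRep 0) (hd : ρ.domain = univ) :
    ρ.value = ρ.integrand (fun i => i.elim0) := by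
  unfold IntegralRep.value
  rw [hd, Measure.restrict_univ, volume_pi, Measure.pi_of_empty _ (fun i => i.elim0), integral_dirac]

/-- Two dimension-0 representations with full domain and the same integrand are equal, hence
equivalent. [folklore] -/
theorem equivalent_of_eq_dim_zero (ρ ρ' : IntegralRep 0) (hd : ρ.domain = univ) (hd' : ρ'.domain = univ)
    (hi : ρ.integrand = ρ'.integrand) : Equivalent ρ ρ' := by
  obtain ⟨d, f, _, _, _⟩ := ρ
  obtain ⟨d', f', _, _, _⟩ := ρ'
  simp only at hd hd' hi
  subst hd hd' hi
  exact Equivalent.refl _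

/-- **The dimension-0 instances are TRUE outright** (not vacuous, not false): for `N = 0` the
test forces `N' = k = 0`, value equality forces `c = 1`, and then `r = r' = [pt, 1]`. So the
degenerate corner is harmless. [folklore] -/
theorem gammaHodgeSector_dim_zero {N' k : ℕ} (x y : Fin 0 → ℚ) (x' y' : Fin N' → ℚ) (c : ℝ)
    (hx' : Admissible x' y') (hH : HodgeCondition 0 N' k x y x' y')
    (r : IntegralRep 0) (r' : IntegralRep (2 * k + N')) (hr : IsCubeBetaRep x y r)
    (hr' : IsBallCubeRep k x' y' c r') (hv : r.value = r'.value) : Equivalent r r' := by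
  obtain ⟨rfl, rfl⟩ := eq_zero_of_N_eq_zero hx' hH
  change IntegralRep 0 at r'
  have hdr : r.domain = univ := by rw [hr.1]; ext; simp
  have hdr' : r'.domain = univ := by rw [hr'.1]; ext; simp
  have hint : r.integrand = r'.integrand := by
    funext z
    have hz : z = fun i => i.elim0 := Subsingleton.elim _ _
    rw [hz, ← value_dim_zero r hdr, ← value_dim_zero r' hdr', hv]
  exact equivalent_of_eq_dim_zero r r' hdr hdr' hint

/-- **Reflection–translation sector `N = 1`, `N' = 0`.** The test forces `k = 1` and
`x₀ + y₀ ∈ ℤ`; these instances read `[(0,1), t^{x−1}(1−t)^{m−x−1}] ~ [unit disc, c]`,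
`B(x, m − x) = c·π` (Euler reflection + translation; `m = 1`, `x = 1/2` is KZ's own §1.1 example
`∫ dx/√(x(1−x))` versus the area of the disc). [folklore] -/
theorem reflection_sector_of_N_one {k : ℕ} {x y : Fin 1 → ℚ} {x' y' : Fin 0 → ℚ}
    (hx : Admissible x y) (hH : HodgeCondition 1 0 k x y x' y') :
    k = 1 ∧ Int.fract (x 0 + y 0) = 0 := by
  have h := hodge_weight_balance hx (fun l => l.elim0) hH
  have hI := intSums_le x y
  have h0' : intSums x' y' = 0 := by simp [intSums]
  have hI1 : intSums x y = 1 := by omega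
  refine ⟨by omega, ?_⟩
  have hsub : (Finset.univ.filter fun j : Fin 1 => Int.fract (x j + y j) = 0) = Finset.univ :=
    Finset.eq_of_subset_of_card_le (Finset.filter_subset _ _) (by simpa [intSums] using hI1.ge)
  have hmem : (0 : Fin 1) ∈ Finset.univ.filter fun j : Fin 1 => Int.fract (x j + y j) = 0 := by
    rw [hsub]; exact Finset.mem_univ _
  exact (Finset.mem_filter.mp hmem).2

/-- **Linear sector `N = N' = 1`.** The test forces `k = 0` and "`x₀+y₀ ∈ ℤ ↔ x'₀+y'₀ ∈ ℤ`"
(e.g. the duplication pairs `B(1/2,s) = 2^{1−2s} B(s,s)` and `DasGapTwelve`). [folklore] -/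
theorem linear_sector_of_N_one_N'_one {k : ℕ} {x y x' y' : Fin 1 → ℚ}
    (hx : Admissible x y) (hx' : Admissible x' y') (hH : HodgeCondition 1 1 k x y x' y') :
    k = 0 ∧ intSums x y = intSums x' y' := by
  have h := hodge_weight_balance hx hx' hH
  have hI := intSums_le x y
  have hI' := intSums_le x' y'
  omega


/-! ## §4 `IsAlgebraic ℚ c` is decoration: it follows from the pinning of `r'`

A `ℚ`-semialgebraic function takes algebraic values at rational points of its domain; the pinned
integrand of `r'` at the rational point `(0,…,0,½,…,½)` is `c · k! · 4^{Σ(1 − x'_l … )}`-ish, an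
algebraic non-zero multiple of `c`. So hypothesis `IsAlgebraic ℚ c` of the crux is implied by the
mere existence of `r'` (`isAlgebraic_of_isBallCubeRep`) and can never be the reason an instance
is vacuous. -/

section Algebraicity

open Literature.ModelTheory.ExponentialFields in
/-- Evaluation of a polynomial in one variable `X₀` with rational coefficients factors through the
univariate polynomial obtained by `X₀ ↦ X`. [folklore] -/
theorem aeval_eq_aeval_uni (p : MvPolynomial (Fin 1) ℚ) (w : Fin 1 → ℝ) :
    MvPolynomial.aeval w p =
      Polynomial.aeval (w 0) (MvPolynomial.aeval (fun _ : Fin 1 => (Polynomial.X : Polynomial ℚ)) p) := by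
  induction p using MvPolynomial.induction_on with
  | C a => simp
  | add p q hp hq => simp only [map_add, hp, hq]
  | mul_X p i hp =>
    have hi : i = 0 := Subsingleton.elim _ _
    subst hi
    simp only [map_mul, hp, MvPolynomial.aeval_X, Polynomial.aeval_X]

open Literature.ModelTheory.ExponentialFields in
/-- **Dimension one, rational coefficients.** Every `ℚ`-semialgebraic subset of `ℝ¹` is, off the
zero set of some non-zero RATIONAL polynomial, both open and closed (induction over the Boolean
algebra; cf. the real-coefficient version `NoSemialgPrim.exists_ne_zero_isOpen` of the barrier
file `AlgebraicPrimitivesObstruction`). [folklore] -/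
theorem exists_clopen_off_zeros {S : Set (Fin 1 → ℝ)} (hS : IsSemialgebraic ℚ S) :
    ∃ q : Polynomial ℚ, q ≠ 0 ∧ IsOpen (S ∩ {w | Polynomial.aeval (w 0) q ≠ 0}) ∧
      IsOpen (Sᶜ ∩ {w | Polynomial.aeval (w 0) q ≠ 0}) := by
  have hcont : ∀ q : Polynomial ℚ, Continuous fun w : Fin 1 → ℝ => Polynomial.aeval (w 0) q :=
    fun q => (Polynomial.continuous_aeval q).comp (continuous_apply 0)
  unfold IsSemialgebraic semialgebraicSets at hS
  induction hS using BooleanSubalgebra.closure_bot_sup_induction with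
  | mem S hS =>
    rcases hS with ⟨p, rfl⟩ | ⟨p, rfl⟩
    · set q := MvPolynomial.aeval (fun _ : Fin 1 => (Polynomial.X : Polynomial ℚ)) p with hq
      have hpq : ∀ w : Fin 1 → ℝ, MvPolynomial.aeval w p = Polynomial.aeval (w 0) q :=
        aeval_eq_aeval_uni p
      by_cases hq0 : q = 0
      · refine ⟨1, one_ne_zero, ?_, ?_⟩
        · convert isOpen_univ
          ext w
          simp [hpq, hq0]
        · convert isOpen_empty
          ext w
          simp [hpq, hq0]
      · refine ⟨q, hq0, ?_, ?_⟩
        · convert isOpen_empty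
          ext w
          simp only [mem_inter_iff, mem_setOf_eq, hpq, mem_empty_iff_false, iff_false, not_and,
            not_not]
          exact fun h => h
        · convert isOpen_ne_fun (hcont q) continuous_const using 1
          ext w
          simp only [mem_inter_iff, mem_compl_iff, mem_setOf_eq, hpq]
          tauto
    · set q := MvPolynomial.aeval (fun _ : Fin 1 => (Polynomial.X : Polynomial ℚ)) p with hq
      have hpq : ∀ w : Fin 1 → ℝ, MvPolynomial.aeval w p = Polynomial.aeval (w 0) q :=
        aeval_eq_aeval_uni p
      by_cases hq0 : q = 0
      · refine ⟨1, one_ne_zero, ?_, ?_⟩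
        · convert isOpen_empty
          ext w
          simp [hpq, hq0]
        · convert isOpen_univ
          ext w
          simp [hpq, hq0]
      · refine ⟨q, hq0, ?_, ?_⟩
        · convert isOpen_lt continuous_const (hcont q) using 1
          ext w
          simp only [mem_inter_iff, mem_setOf_eq, hpq]
          exact ⟨fun h => h.1, fun h => ⟨h, h.ne'⟩⟩
        · convert isOpen_lt (hcont q) continuous_const using 1
          ext w
          simp only [mem_inter_iff, mem_compl_iff, mem_setOf_eq, hpq, not_lt]
          exact ⟨fun h => lt_of_le_of_ne h.1 h.2, fun h => ⟨h.le, h.ne⟩⟩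
  | bot => exact ⟨1, one_ne_zero, by simp, by simp⟩
  | sup S _ T _ ihS ihT =>
    obtain ⟨p, hp, hp1, hp2⟩ := ihS
    obtain ⟨q, hq, hq1, hq2⟩ := ihT
    refine ⟨p * q, mul_ne_zero hp hq, ?_, ?_⟩
    · have : ((S ⊔ T) ∩ {w : Fin 1 → ℝ | Polynomial.aeval (w 0) (p * q) ≠ 0}) =
          (S ∩ {w | Polynomial.aeval (w 0) p ≠ 0}) ∩ {w | Polynomial.aeval (w 0) q ≠ 0} ∪
            (T ∩ {w | Polynomial.aeval (w 0) q ≠ 0}) ∩ {w | Polynomial.aeval (w 0) p ≠ 0} := by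
        ext w
        simp only [sup_eq_union, mem_inter_iff, mem_union, mem_setOf_eq, map_mul, mul_ne_zero_iff]
        tauto
      rw [this]
      exact (hp1.inter (isOpen_ne_fun (hcont q) continuous_const)).union
        (hq1.inter (isOpen_ne_fun (hcont p) continuous_const))
    · have : ((S ⊔ T)ᶜ ∩ {w : Fin 1 → ℝ | Polynomial.aeval (w 0) (p * q) ≠ 0}) =
          (Sᶜ ∩ {w | Polynomial.aeval (w 0) p ≠ 0}) ∩ (Tᶜ ∩ {w | Polynomial.aeval (w 0) q ≠ 0}) := by
        ext w
        simp only [sup_eq_union, compl_union, mem_inter_iff, mem_compl_iff, mem_setOf_eq, map_mul,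
          mul_ne_zero_iff]
        tauto
      rw [this]
      exact hp2.inter hq2
  | compl S _ ih =>
    obtain ⟨p, hp, h1, h2⟩ := ih
    exact ⟨p, hp, h2, by simpa only [compl_compl] using h1⟩

/-- **A `ℚ`-semialgebraic point of `ℝ¹` is algebraic**: if `{w₀}` is `ℚ`-semialgebraic then
`w₀` is a root of the non-zero rational polynomial of `exists_clopen_off_zeros` (otherwise `{w₀}`
would contain an interval). [folklore] -/
theorem isAlgebraic_of_isSemialgebraic_singleton {w₀ : Fin 1 → ℝ}
    (h : IsSemialgebraic ℚ ({w₀} : Set (Fin 1 → ℝ))) : IsAlgebraic ℚ (w₀ 0) := by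
  obtain ⟨q, hq0, hopen, -⟩ := exists_clopen_off_zeros h
  by_cases hroot : Polynomial.aeval (w₀ 0) q = 0
  · exact ⟨q, hq0, hroot⟩
  · exfalso
    have hmem : w₀ ∈ ({w₀} : Set (Fin 1 → ℝ)) ∩ {w | Polynomial.aeval (w 0) q ≠ 0} := ⟨rfl, hroot⟩
    obtain ⟨ε, hε, hball⟩ := Metric.isOpen_iff.mp hopen w₀ hmem
    have hmem' : (fun _ => w₀ 0 + ε / 2 : Fin 1 → ℝ) ∈ Metric.ball w₀ ε := by
      rw [Metric.mem_ball, dist_pi_lt_iff hε]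
      intro i
      rw [Subsingleton.elim i 0, Real.dist_eq, add_sub_cancel_left, abs_of_pos (half_pos hε)]
      exact half_lt_self hε
    have h0 := congr_fun (mem_singleton_iff.mp (hball hmem').1) 0
    simp only [add_eq_left] at h0
    exact absurd h0 (half_pos hε).ne'

/-- **Semialgebraic functions take algebraic values at rational points** (slice the graph at the
rational point by a polynomial substitution — `IsSemialgebraic.preimage_aeval`, no
Tarski–Seidenberg — and apply `isAlgebraic_of_isSemialgebraic_singleton`). [folklore] -/
theorem isAlgebraic_apply_ratCast {m : ℕ} {s : Set (Fin m → ℝ)} {f : (Fin m → ℝ) → ℝ}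
    (hf : IsSemialgebraicFunOn ℚ s f) (z : Fin m → ℚ) (hz : (fun i => (z i : ℝ)) ∈ s) :
    IsAlgebraic ℚ (f fun i => (z i : ℝ)) := by
  rw [isSemialgebraicFunOn_iff] at hf
  set P : Fin (m + 1) → MvPolynomial (Fin 1) ℚ :=
    Fin.snoc (fun i => MvPolynomial.C (z i)) (MvPolynomial.X 0) with hPdef
  have hP : ∀ v : Fin 1 → ℝ,
      (fun j => MvPolynomial.aeval v (P j)) = Fin.snoc (fun i => (z i : ℝ)) (v 0) := by
    intro v
    ext j
    refine Fin.lastCases ?_ (fun i => ?_) j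
    · simp [hPdef]
    · simp [hPdef]
  have hT := hf.preimage_aeval P
  have hsing : IsSemialgebraic ℚ ({fun _ : Fin 1 => f (fun i => (z i : ℝ))} : Set (Fin 1 → ℝ)) := by
    convert hT using 1
    ext v
    simp only [mem_singleton_iff, mem_preimage, mem_setOf_eq, hP v, Fin.init_snoc, Fin.snoc_last]
    constructor
    · rintro rfl
      exact ⟨hz, rfl⟩
    · rintro ⟨-, hv⟩
      funext i
      rw [Subsingleton.elim i 0]
      exact hv
  exact isAlgebraic_of_isSemialgebraic_singleton hsing

/-- `(1/2)^q` is algebraic for rational `q`. [folklore] -/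
theorem isAlgebraic_half_rpow (q : ℚ) : IsAlgebraic ℚ ((1 / 2 : ℝ) ^ (q : ℝ)) := by
  have h := KoblitzOgus.isAlgebraic_nat_rpow_rat (m := 2) two_pos q.num q.den_pos
  have hq : ((q.num : ℝ) / (q.den : ℕ)) = (q : ℝ) := by
    rw [Rat.cast_def]
  rw [hq, Nat.cast_ofNat] at h
  rw [one_div, Real.inv_rpow (by norm_num : (0 : ℝ) ≤ 2)]
  exact h.inv

/-- **`IsAlgebraic ℚ c` is implied by the pinning of `r'`.** If some representation `r'` is
pinned as `[ball × cube, c · k! · Π …]` then `c` is algebraic: evaluate the (semialgebraic)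
integrand at the rational point `(0,…,0,½,…,½)` of the domain. So this hypothesis of the crux
is decoration (it can be neither load-bearing nor a source of vacuity). [folklore] -/
theorem isAlgebraic_of_isBallCubeRep {N' k : ℕ} {x' y' : Fin N' → ℚ} {c : ℝ}
    {r' : IntegralRep (2 * k + N')} (hr' : IsBallCubeRep k x' y' c r') : IsAlgebraic ℚ c := by
  set z : Fin (2 * k + N') → ℚ :=
    Fin.append (fun _ : Fin (2 * k) => (0 : ℚ)) (fun _ : Fin N' => 1 / 2) with hzdef
  have hzl : ∀ i : Fin (2 * k), z (Fin.castAdd N' i) = 0 := fun i => by simp [hzdef]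
  have hzr : ∀ l : Fin N', z (Fin.natAdd (2 * k) l) = 1 / 2 := fun l => by simp [hzdef]
  have h12 : ∀ l : Fin N', ((z (Fin.natAdd (2 * k) l) : ℚ) : ℝ) = 1 / 2 := fun l => by
    rw [hzr]; norm_num
  have hz : (fun i => (z i : ℝ)) ∈ r'.domain := by
    rw [hr'.1]
    refine ⟨?_, fun l => ?_⟩
    · simp [hzl]
    · simp only [mem_Ioo, h12]
      norm_num
  -- the value of the integrand there
  set A : ℝ := (k.factorial : ℝ) *
    ∏ l : Fin N', ((1 / 2 : ℝ) ^ ((x' l : ℝ) - 1) * (1 / 2 : ℝ) ^ ((y' l : ℝ) - 1)) with hA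
  have hval : r'.integrand (fun i => (z i : ℝ)) = c * A := by
    rw [hr'.2 hz]
    simp only [h12, hA]
    ring
  have halg : IsAlgebraic ℚ (c * A) := by
    rw [← hval]
    exact isAlgebraic_apply_ratCast r'.isSemialgebraicFunOn_integrand z hz
  -- `A` is algebraic and non-zero
  have hApos : 0 < A := by
    refine mul_pos (by exact_mod_cast Nat.factorial_pos k) (Finset.prod_pos fun l _ => ?_)
    exact mul_pos (Real.rpow_pos_of_pos (by norm_num) _) (Real.rpow_pos_of_pos (by norm_num) _)
  have hAalg : IsAlgebraic ℚ A := by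
    rw [isAlgebraic_iff_isIntegral]
    refine IsIntegral.mul (isAlgebraic_iff_isIntegral.mp (isAlgebraic_nat _)) ?_
    refine IsIntegral.prod _ fun l _ => IsIntegral.mul ?_ ?_
    · have h := isAlgebraic_half_rpow (x' l - 1)
      rw [Rat.cast_sub, Rat.cast_one] at h
      exact isAlgebraic_iff_isIntegral.mp h
    · have h := isAlgebraic_half_rpow (y' l - 1)
      rw [Rat.cast_sub, Rat.cast_one] at h
      exact isAlgebraic_iff_isIntegral.mp h
  have hc : c = c * A * A⁻¹ := by field_simp
  rw [hc]
  exact halg.mul hAalg.inv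

/-- Hence the crux is equivalent to its version WITHOUT the algebraicity hypothesis. [folklore] -/
theorem gammaHodgeSector_iff_without_isAlgebraic :
    GammaHodgeSector ↔
      ∀ (N N' k : ℕ) (x y : Fin N → ℚ) (x' y' : Fin N' → ℚ) (c : ℝ),
        Admissible x y → Admissible x' y' → HodgeCondition N N' k x y x' y' →
        ∀ (r : IntegralRep N) (r' : IntegralRep (2 * k + N')),
          IsCubeBetaRep x y r → IsBallCubeRep k x' y' c r' → r.value = r'.value → Equivalent r r' := by
  rw [gammaHodgeSector_iff]
  constructor
  · intro h N N' k x y x' y' c hx hx' hH r r' hr hr' hv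
    exact h N N' k x y x' y' c hx hx' hH (isAlgebraic_of_isBallCubeRep hr') r r' hr hr' hv
  · intro h N N' k x y x' y' c hx hx' hH _ r r' hr hr' hv
    exact h N N' k x y x' y' c hx hx' hH r r' hr hr' hv

end Algebraicity


/-! ## §5 Non-vacuity, certified: the calibration instance is KZ's own §1.1 example

`(N, N', k) = (1, 0, 1)`, `x = y = ½`, `c = 1`: the hypotheses of the crux hold for
`r = [(0,1), t^{−1/2}(1−t)^{−1/2}]` (`arcsineRep`, value `B(½,½) = π`) and `r' = [open unit disc, 1]`
(`discRep`, value `π`), all checked below (`calibration_hypotheses`). So the crux asserts in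
particular `arcsineRep ~ discRep` (`calibration_of_gammaHodgeSector`) — after the affine change
`t = (1+x)/2` this is literally KZ 2001 §1.1, `∫_{−1}^{1} dx/√(1−x²) = π`: a 4–5 move chain
(rule 2 affine; KZ's Newton–Leibniz identity `2√(1−x²) − 1/√(1−x²) = (x√(1−x²))'`; rule 3 for
the area under `±√(1−x²)`; rule 1). This is the smallest non-degenerate instance and the natural
first target for a prover; it is NOT claimed here. -/

section Calibration

open Literature.ModelTheory.ExponentialFields (isSemialgebraic_setOf_eval_pos)

/-- The real beta integrand `x^{α−1}(1−x)^{β−1}` is integrable on `(0,1)` with integral `B(α, β)`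
(read off from Mathlib's normalised beta density `ProbabilityTheory.lintegral_betaPDF_eq_one`;
a copy of the tree's private lemma in `KontsevichZagier.lean`). [folklore] -/
theorem integrableOn_betaIntegrand_and_integral_eq {α β : ℝ} (hα : 0 < α) (hβ : 0 < β) :
    IntegrableOn (fun x : ℝ => x ^ (α - 1) * (1 - x) ^ (β - 1)) (Ioo 0 1) ∧
      ∫ x in Ioo (0 : ℝ) 1, x ^ (α - 1) * (1 - x) ^ (β - 1) = ProbabilityTheory.beta α β := by
  have hc0 : 0 < ProbabilityTheory.beta α β := ProbabilityTheory.beta_pos hα hβ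
  set g : ℝ → ℝ := fun x => 1 / ProbabilityTheory.beta α β * x ^ (α - 1) * (1 - x) ^ (β - 1)
    with hg
  have hlin : ∫⁻ x in Ioo (0 : ℝ) 1, ENNReal.ofReal (g x) = 1 := by
    rw [hg, ← ProbabilityTheory.lintegral_betaPDF, ProbabilityTheory.lintegral_betaPDF_eq_one hα hβ]
  have hg0 : 0 ≤ᵐ[volume.restrict (Ioo (0 : ℝ) 1)] g := by
    refine ae_restrict_of_forall_mem measurableSet_Ioo fun x hx => ?_
    have h1 : 0 ≤ x ^ (α - 1) := Real.rpow_nonneg hx.1.le _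
    have h2 : 0 ≤ (1 - x) ^ (β - 1) := Real.rpow_nonneg (by linarith [hx.2]) _
    simp only [hg, Pi.zero_apply]
    exact mul_nonneg (mul_nonneg (by positivity) h1) h2
  have hgm : AEStronglyMeasurable g (volume.restrict (Ioo (0 : ℝ) 1)) :=
    Measurable.aestronglyMeasurable (by fun_prop)
  have hgi : Integrable g (volume.restrict (Ioo (0 : ℝ) 1)) :=
    ⟨hgm, (hasFiniteIntegral_iff_ofReal hg0).2 (by simp [hlin])⟩
  have hgint : ∫ x in Ioo (0 : ℝ) 1, g x = 1 := by
    rw [integral_eq_lintegral_of_nonneg_ae hg0 hgm, hlin]; simp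
  have hfg : (fun x : ℝ => x ^ (α - 1) * (1 - x) ^ (β - 1)) =
      fun x => ProbabilityTheory.beta α β * g x := by
    funext x
    simp only [hg]
    field_simp
  refine ⟨?_, ?_⟩
  · rw [hfg]; exact hgi.const_mul _
  · rw [hfg, integral_const_mul, hgint, mul_one]

/-- `B(½, ½) = π` (`Γ(½)² / Γ(1)`). [folklore] -/
theorem beta_half_half : ProbabilityTheory.beta (1 / 2) (1 / 2) = Real.pi := by
  rw [ProbabilityTheory.beta, Real.Gamma_one_half_eq, show (1 / 2 : ℝ) + 1 / 2 = 1 by norm_num,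
    Real.Gamma_one, div_one, Real.mul_self_sqrt Real.pi_pos.le]

/-- The open unit interval `(0,1) ⊆ ℝ¹`, in the crux's form `{t | ∀ j, t j ∈ (0,1)}`. [folklore] -/
def unitIntervalDomain : Set (Fin 1 → ℝ) := {t | ∀ j : Fin 1, t j ∈ Ioo (0:ℝ) 1}

/-- Membership in `unitIntervalDomain`. [folklore] -/
theorem mem_unitIntervalDomain {t : Fin 1 → ℝ} : t ∈ unitIntervalDomain ↔ t 0 ∈ Ioo (0:ℝ) 1 := by
  simp [unitIntervalDomain, Fin.forall_fin_one]

/-- `unitIntervalDomain` is the preimage of `(0,1)` under `ℝ¹ ≃ ℝ`. [folklore] -/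
theorem unitIntervalDomain_eq_preimage :
    unitIntervalDomain = (MeasurableEquiv.funUnique (Fin 1) ℝ) ⁻¹' Ioo 0 1 := by
  ext t
  rw [mem_unitIntervalDomain, mem_preimage]
  simp [MeasurableEquiv.funUnique]

/-- `unitIntervalDomain` is `ℚ`-semialgebraic (`0 < X₀`, `0 < 1 − X₀`). [folklore] -/
theorem isSemialgebraic_unitIntervalDomain : IsSemialgebraic ℚ unitIntervalDomain := by
  have h1 := isSemialgebraic_setOf_eval_pos (k := ℚ) (R := ℝ) (MvPolynomial.X 0 : MvPolynomial (Fin 1) ℚ)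
  have h2 := isSemialgebraic_setOf_eval_pos (k := ℚ) (R := ℝ)
    (1 - MvPolynomial.X 0 : MvPolynomial (Fin 1) ℚ)
  convert h1.inter h2 using 1
  ext t
  simp [mem_unitIntervalDomain, sub_pos]

/-- `unitIntervalDomain` is measurable. [folklore] -/
theorem measurableSet_unitIntervalDomain : MeasurableSet unitIntervalDomain := by
  rw [unitIntervalDomain_eq_preimage]
  exact (MeasurableEquiv.funUnique (Fin 1) ℝ).measurable measurableSet_Ioo

/-- The arcsine integrand `t^{−1/2}(1−t)^{−1/2}` on `ℝ¹`. [folklore] -/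
def arcsineFun (t : Fin 1 → ℝ) : ℝ := (t 0) ^ (-(1 / 2 : ℝ)) * (1 - t 0) ^ (-(1 / 2 : ℝ))

/-- On `(0,1)`: `t^{−1/2}(1−t)^{−1/2} = 1/√(t(1−t))`. [folklore] -/
theorem arcsineFun_eq_inv_sqrt {t : Fin 1 → ℝ} (ht : t ∈ unitIntervalDomain) :
    arcsineFun t = (Real.sqrt (t 0 * (1 - t 0)))⁻¹ := by
  rw [mem_unitIntervalDomain] at ht
  have h0 : 0 ≤ t 0 := ht.1.le
  have h1 : 0 ≤ 1 - t 0 := by linarith [ht.2]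
  rw [arcsineFun, Real.sqrt_mul h0, mul_inv, Real.sqrt_eq_rpow, Real.sqrt_eq_rpow,
    Real.rpow_neg h0, Real.rpow_neg h1]

/-- The arcsine integrand is `ℚ`-semialgebraic on `(0,1)` (graph of `1/√(X₀(1−X₀))`; the tree's
closure lemmas `fun_mul`, `fun_sqrt`, `fun_inv`). [folklore] -/
theorem isSemialgebraicFunOn_arcsineFun : IsSemialgebraicFunOn ℚ unitIntervalDomain arcsineFun := by
  have hW := isSemialgebraic_unitIntervalDomain
  have hx : IsSemialgebraicFunOn ℚ unitIntervalDomain (fun t => t 0) :=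
    (isSemialgebraicFunOn_aeval hW (MvPolynomial.X 0)).congr fun t _ => by simp
  have h1x : IsSemialgebraicFunOn ℚ unitIntervalDomain (fun t => 1 - t 0) :=
    (isSemialgebraicFunOn_aeval hW (1 - MvPolynomial.X 0)).congr fun t _ => by simp
  exact ((hx.fun_mul h1x).fun_sqrt.fun_inv).congr fun t ht => (arcsineFun_eq_inv_sqrt ht).symm

/-- The arcsine integrand is the beta integrand `(½, ½)` transported along `ℝ¹ ≃ ℝ`. [folklore] -/
theorem arcsineFun_eq_comp :
    arcsineFun = (fun x : ℝ => x ^ ((1 / 2 : ℝ) - 1) * (1 - x) ^ ((1 / 2 : ℝ) - 1)) ∘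
      (MeasurableEquiv.funUnique (Fin 1) ℝ) := by
  funext t
  simp only [arcsineFun, Function.comp_apply]
  rw [show ((1 / 2 : ℝ) - 1) = -(1 / 2) by norm_num]
  simp [MeasurableEquiv.funUnique]

/-- The arcsine integrand is integrable on `(0,1)`. [folklore] -/
theorem integrableOn_arcsineFun : IntegrableOn arcsineFun unitIntervalDomain := by
  have h := (integrableOn_betaIntegrand_and_integral_eq (α := 1 / 2) (β := 1 / 2)
    (by norm_num) (by norm_num)).1
  rw [unitIntervalDomain_eq_preimage, arcsineFun_eq_comp]
  exact ((volume_preserving_funUnique (Fin 1) ℝ).integrableOn_comp_preimage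
    (MeasurableEquiv.measurableEmbedding _)).mpr h

/-- `∫_{(0,1)} t^{−1/2}(1−t)^{−1/2} dt = π`. [folklore] -/
theorem setIntegral_arcsineFun : ∫ t in unitIntervalDomain, arcsineFun t = Real.pi := by
  have h := (integrableOn_betaIntegrand_and_integral_eq (α := 1 / 2) (β := 1 / 2)
    (by norm_num) (by norm_num)).2
  rw [beta_half_half] at h
  rw [unitIntervalDomain_eq_preimage, arcsineFun_eq_comp, ← h]
  exact (volume_preserving_funUnique (Fin 1) ℝ).setIntegral_preimage_emb
    (MeasurableEquiv.measurableEmbedding _)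
    (fun x : ℝ => x ^ ((1 / 2 : ℝ) - 1) * (1 - x) ^ ((1 / 2 : ℝ) - 1)) (Ioo 0 1)

/-- **The arcsine representation** `[(0,1), t^{−1/2}(1−t)^{−1/2}]` (the cube representation of
the crux at `N = 1`, `x = y = ½`). [cite: KontsevichZagier2001, §1.1] -/
def arcsineRep : IntegralRep 1 where
  domain := unitIntervalDomain
  integrand := arcsineFun
  isSemialgebraic_domain := isSemialgebraic_unitIntervalDomain
  isSemialgebraicFunOn_integrand := isSemialgebraicFunOn_arcsineFun
  integrableOn := integrableOn_arcsineFun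

/-- `value arcsineRep = π` (`= B(½,½)`). [cite: KontsevichZagier2001, §1.1] -/
theorem arcsineRep_value : arcsineRep.value = Real.pi := setIntegral_arcsineFun

/-- The open unit disc `{z₀² + z₁² < 1} ⊆ ℝ²`. [cite: KontsevichZagier2001, §1.1 eq. (1)] -/
def unitDisc : Set (Fin 2 → ℝ) := {z | z 0 ^ 2 + z 1 ^ 2 < 1}

/-- The open unit disc is `ℚ`-semialgebraic. [folklore] -/
theorem isSemialgebraic_unitDisc : IsSemialgebraic ℚ unitDisc := by
  have h := isSemialgebraic_setOf_eval_pos (k := ℚ) (R := ℝ)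
    (1 - MvPolynomial.X 0 ^ 2 - MvPolynomial.X 1 ^ 2 : MvPolynomial (Fin 2) ℚ)
  convert h using 1
  ext z
  simp only [unitDisc, mem_setOf_eq, map_sub, map_one, map_pow, MvPolynomial.aeval_X]
  constructor <;> intro hz <;> linarith

/-- The open unit disc is open, hence measurable. [folklore] -/
theorem measurableSet_unitDisc : MeasurableSet unitDisc :=
  (isOpen_lt (by fun_prop) continuous_const).measurableSet

/-- **Area of the open unit disc** `= π` (transported from `Complex.volume_ball`). [folklore] -/
theorem volume_unitDisc : volume unitDisc = ENNReal.ofReal Real.pi := by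
  have hpre : Complex.measurableEquivPi ⁻¹' unitDisc = Metric.ball (0 : ℂ) 1 := by
    ext a
    rw [mem_preimage, Complex.measurableEquivPi_apply, mem_ball_zero_iff,
      ← sq_lt_one_iff₀ (norm_nonneg a), Complex.sq_norm, Complex.normSq_apply]
    simp [sq, unitDisc]
  rw [← Complex.volume_preserving_equiv_pi.measure_preimage
    measurableSet_unitDisc.nullMeasurableSet, hpre, Complex.volume_ball,
    ← NNReal.coe_real_pi, ENNReal.ofReal_coe_nnreal]
  simp

/-- **The disc representation** `[open unit disc, 1]` (the ball × cube representation of the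
crux at `k = 1`, `N' = 0`, `c = 1`). [cite: KontsevichZagier2001, §1.1 eq. (1)] -/
def discRep : IntegralRep 2 where
  domain := unitDisc
  integrand := fun _ => 1
  isSemialgebraic_domain := isSemialgebraic_unitDisc
  isSemialgebraicFunOn_integrand := by
    simpa using isSemialgebraicFunOn_aeval isSemialgebraic_unitDisc (1 : MvPolynomial (Fin 2) ℚ)
  integrableOn := integrableOn_const (by simp [volume_unitDisc])

/-- `value discRep = π`. [cite: KontsevichZagier2001, §1.1 eq. (1)] -/
theorem discRep_value : discRep.value = Real.pi := by
  rw [IntegralRep.value, show discRep.domain = unitDisc from rfl,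
    show discRep.integrand = fun _ => (1 : ℝ) from rfl, setIntegral_const, measureReal_def,
    volume_unitDisc, ENNReal.toReal_ofReal Real.pi_pos.le, smul_eq_mul, mul_one]

/-- `{u/2} = ½` for odd `u`. [folklore] -/
theorem fract_odd_mul_half {u : ℕ} (hu : Odd u) : Int.fract ((u : ℚ) * (1 / 2)) = 1 / 2 := by
  obtain ⟨m, rfl⟩ := hu
  have : (((2 * m + 1 : ℕ) : ℚ) * (1 / 2)) = ((m : ℤ) : ℚ) + 1 / 2 := by push_cast; ring
  rw [this, Int.fract_intCast_add, Int.fract_eq_self.mpr ⟨by norm_num, by norm_num⟩]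

/-- **All hypotheses of the crux hold for the calibration instance** `(N,N',k) = (1,0,1)`,
`x = y = ½`, `c = 1`, `r = arcsineRep`, `r' = discRep` (admissibility; the Hodge-type test: for
odd `u`, `{u/2} + {u/2} − {u} = 1 = k`; `1` algebraic; the two pinnings; value equality
`π = π`). Certified non-vacuity of a non-degenerate instance. [folklore] -/
theorem calibration_hypotheses :
    Admissible (fun _ : Fin 1 => (1 / 2 : ℚ)) (fun _ => 1 / 2) ∧
    Admissible (N := 0) Fin.elim0 Fin.elim0 ∧
    HodgeCondition 1 0 1 (fun _ => (1 / 2 : ℚ)) (fun _ => 1 / 2) Fin.elim0 Fin.elim0 ∧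
    IsAlgebraic ℚ (1 : ℝ) ∧
    IsCubeBetaRep (fun _ : Fin 1 => (1 / 2 : ℚ)) (fun _ => 1 / 2) arcsineRep ∧
    IsBallCubeRep (N' := 0) 1 Fin.elim0 Fin.elim0 1 discRep ∧
    arcsineRep.value = discRep.value := by
  have hfr : Int.fract (1 / 2 : ℚ) = 1 / 2 := Int.fract_eq_self.mpr ⟨by norm_num, by norm_num⟩
  have hden : (1 / 2 : ℚ).den = 2 := by rw [one_div, Rat.inv_ofNat_den]
  refine ⟨fun _ => ⟨by norm_num, by norm_num, by rw [hfr]; norm_num, by rw [hfr]; norm_num⟩,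
    admissible_elim0, ?_, isAlgebraic_one, ?_, ?_, ?_⟩
  · -- the Hodge-type test
    intro u _ hcop _
    have hodd : Odd u := Nat.coprime_two_right.mp (hden ▸ (hcop 0).1)
    have hsum : Int.fract ((u : ℚ) * (1 / 2 + 1 / 2)) = 0 := by
      rw [show (1 / 2 : ℚ) + 1 / 2 = 1 by norm_num, mul_one, Int.fract_natCast]
    simp only [hodgeSum, Finset.univ_unique, Fin.default_eq_zero, Finset.sum_singleton,
      fract_odd_mul_half hodd, hsum, Finset.univ_eq_empty, Finset.sum_empty]
    norm_num
  · -- `arcsineRep` is the cube representation at `x = y = ½`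
    refine ⟨rfl, fun t _ => ?_⟩
    simp only [arcsineRep, arcsineFun, Fin.prod_univ_one]
    push_cast
    norm_num
  · -- `discRep` is the ball × cube representation at `k = 1`, `N' = 0`, `c = 1`
    refine ⟨?_, fun z _ => ?_⟩
    · ext z
      simp [discRep, unitDisc, Fin.sum_univ_two]
    · simp [discRep]
  · rw [arcsineRep_value, discRep_value]

/-- **The crux contains KZ's §1.1 example**: `GammaHodgeSector → arcsineRep ~ discRep`
(`∫₀¹ dt/√(t(1−t))` versus the area of the unit disc). The natural first target for a prover
(a 4–5 move chain after `t = (1+x)/2`; not claimed here). [cite: KontsevichZagier2001, §1.1] -/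
theorem calibration_of_gammaHodgeSector (h : GammaHodgeSector) : Equivalent arcsineRep discRep := by
  obtain ⟨hx, hx', hH, halg, hr, hr', hv⟩ := calibration_hypotheses
  exact (gammaHodgeSector_iff.mp h) 1 0 1 _ _ _ _ 1 hx hx' hH halg arcsineRep discRep hr hr' hv

/-! ### The calibration instance is the instance `a = ½` of `EulerReflectionRational`
(stmt-KontsevichZagierPeriods-3383, route CompiledSubstitutions), up to the null unit circle -/

/-- The unit circle `{z₀² + z₁² = 1} ⊆ ℝ²`. [folklore] -/
def unitCircle : Set (Fin 2 → ℝ) := {z | z 0 ^ 2 + z 1 ^ 2 = 1}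

/-- The unit circle is `ℚ`-semialgebraic. [folklore] -/
theorem isSemialgebraic_unitCircle : IsSemialgebraic ℚ unitCircle := by
  have h := Literature.ModelTheory.ExponentialFields.isSemialgebraic_setOf_eval_eq_zero (k := ℚ) (R := ℝ)
    (MvPolynomial.X 0 ^ 2 + MvPolynomial.X 1 ^ 2 - 1 : MvPolynomial (Fin 2) ℚ)
  convert h using 1
  ext z
  simp only [unitCircle, mem_setOf_eq, map_sub, map_add, map_one, map_pow, MvPolynomial.aeval_X,
    sub_eq_zero]

/-- The closed disc is the open disc plus the circle. [folklore] -/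
theorem piDisc_eq_union : piDisc = unitDisc ∪ unitCircle := by
  ext z
  simp only [mem_piDisc, unitDisc, unitCircle, mem_union, mem_setOf_eq]
  exact le_iff_lt_or_eq

/-- The unit circle is the closed disc minus the open disc. [folklore] -/
theorem unitCircle_eq_diff : unitCircle = piDisc \ unitDisc := by
  ext z
  simp only [mem_piDisc, unitDisc, unitCircle, mem_sdiff, mem_setOf_eq, not_lt]
  constructor
  · intro h
    exact ⟨h.le, h.ge⟩
  · intro h
    exact le_antisymm h.1 h.2

/-- **The unit circle is Lebesgue-null** (`π − π`, from the two disc areas). [folklore] -/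
theorem volume_unitCircle : volume unitCircle = 0 := by
  have hsub : unitDisc ⊆ piDisc := fun z hz => le_of_lt (α := ℝ) hz
  rw [unitCircle_eq_diff, measure_sdiff hsub measurableSet_unitDisc.nullMeasurableSet
    (by simp [volume_unitDisc]), volume_piDisc, volume_unitDisc, tsub_self]

/-- The circle representation `[unit circle, 1]` (a null representation). [folklore] -/
def circleRep : IntegralRep 2 where
  domain := unitCircle
  integrand := fun _ => 1
  isSemialgebraic_domain := isSemialgebraic_unitCircle
  isSemialgebraicFunOn_integrand := by
    simpa using isSemialgebraicFunOn_aeval isSemialgebraic_unitCircle (1 : MvPolynomial (Fin 2) ℚ)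
  integrableOn := integrableOn_const (by simp [volume_unitCircle])

/-- A representation on a null domain is a relation (domain additivity `σ = σ ∪ σ`). [folklore] -/
theorem of_circleRep_mem_relations : KZ.of circleRep ∈ relations := by
  have h : KZ.of circleRep - KZ.of circleRep - KZ.of circleRep ∈ domainAddRel :=
    ⟨2, circleRep, circleRep, circleRep, (union_self _).symm, by simp [circleRep, volume_unitCircle],
      fun _ _ => rfl, fun _ _ => rfl, rfl⟩
  have h' := relations.neg_mem (domainAddRel_subset_relations h)
  convert h' using 1
  abel

/-- **`[closed disc, 1] ~ [open disc, 1]`** (one domain-additivity move along the null circle, plus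
the null circle representation). [folklore] -/
theorem equivalent_piRep_discRep : Equivalent piRep discRep := by
  have h : KZ.of piRep - KZ.of discRep - KZ.of circleRep ∈ domainAddRel :=
    ⟨2, piRep, discRep, circleRep, piDisc_eq_union, ?_, fun _ _ => rfl, fun _ _ => rfl, rfl⟩
  · have h1 := domainAddRel_subset_relations h
    have h2 := of_circleRep_mem_relations
    have : KZ.of piRep - KZ.of discRep =
        (KZ.of piRep - KZ.of discRep - KZ.of circleRep) + KZ.of circleRep := by abel
    show KZ.of piRep - KZ.of discRep ∈ relations
    rw [this]
    exact relations.add_mem h1 h2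
  · refine measure_mono_null (fun z hz => hz.2) ?_
    exact volume_unitCircle

open Summit.KontsevichZagierPeriods.KontsevichZagierPeriods.Theses.CompiledSubstitutions (EulerReflectionRational) in
/-- **The calibration instance is the instance `a = ½` of `EulerReflectionRational`**
(stmt-KontsevichZagierPeriods-3383, route CompiledSubstitutions: `[sin(πa) x^{a−1}(1−x)^{−a}] ~
[closed unit disc, 1]`): with `sin(π/2) = 1` and `[closed disc] ~ [open disc]` it gives
`arcsineRep ~ discRep`. So the smallest instance of `GammaHodgeSector` is shared with item 3383;
more generally the whole slice `N = 1, N' = 0, x + y = 1` of the reflection sector is 3383 scaled by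
the algebraic constant `1/sin(πx)`. [folklore] -/
theorem calibration_of_eulerReflectionRational (h : EulerReflectionRational) :
    Equivalent arcsineRep discRep := by
  have hr : arcsineRep.domain = {x | x 0 ∈ Ioo (0:ℝ) 1} := by
    ext t
    exact mem_unitIntervalDomain
  have hi : EqOn arcsineRep.integrand
      (fun x => Real.sin (Real.pi * (1 / 2 : ℚ)) * (x 0) ^ (((1 / 2 : ℚ) : ℝ) - 1) *
        (1 - x 0) ^ (-((1 / 2 : ℚ) : ℝ))) arcsineRep.domain := by
    intro t _
    have hsin : Real.sin (Real.pi * (1 / 2 : ℚ)) = 1 := by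
      rw [show (Real.pi * (1 / 2 : ℚ) : ℝ) = Real.pi / 2 by push_cast; ring, Real.sin_pi_div_two]
    simp only [arcsineRep, arcsineFun, hsin, one_mul]
    push_cast
    norm_num
  have h1 : Equivalent arcsineRep piRep :=
    h (1 / 2) (by norm_num) (by norm_num) arcsineRep piRep hr hi rfl (fun _ _ => rfl)
  exact h1.trans equivalent_piRep_discRep

end Calibration


/-! ## §6 A refuted strengthening: the unit quantifier `∀ u` of the Hodge test is essential

The natural EXISTENTIAL form of the sector ("for Hodge-type data the cube representation is
equivalent to SOME `[ball × cube, c·k!·Π]`") is the crux plus Deligne/Koblitz–Ogus (the tree's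
`deligne_gammaMonomial_algebraic_holds` supplies the algebraic `c` making the values agree), hence
summit-implied and not attackable. But the same form with the test required ONLY AT `u = 1` is
FALSE (`not_gammaHodgeSectorExistsAtOne`): `x = y = ¼` passes the `u = 1` test with `k = 0`, and an
equivalence `[(0,1), t^{−3/4}(1−t)^{−3/4}] ~ [pt, c]` would make `B(¼,¼) = Γ(¼)²/√π` algebraic,
against Chudnovsky (`π`, `Γ(¼)` algebraically independent — PROVED in the tree,
`algebraicIndependent_real_pi_gamma_one_quarter`). So the decidable test of the crux cannot be
cheapened to its `u = 1` instance. -/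

section Strengthening

/-- The Hodge-type test at the single unit `u = 1`. [folklore] -/
def HodgeConditionAtOne (N N' k : ℕ) (x y : Fin N → ℚ) (x' y' : Fin N' → ℚ) : Prop :=
  hodgeSum x y 1 - hodgeSum x' y' 1 = (k : ℚ)

/-- The full test implies the test at `u = 1`. [folklore] -/
theorem HodgeCondition.atOne {N N' k : ℕ} {x y : Fin N → ℚ} {x' y' : Fin N' → ℚ}
    (h : HodgeCondition N N' k x y x' y') : HodgeConditionAtOne N N' k x y x' y' :=
  h 1 one_pos (fun _ => ⟨Nat.coprime_one_left _, Nat.coprime_one_left _⟩)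
    (fun _ => ⟨Nat.coprime_one_left _, Nat.coprime_one_left _⟩)

/-- STRENGTHENING (refuted below): the existential form of the sector with the Hodge-type test
required only at `u = 1` — "for admissible data passing the `u = 1` test, the cube representation
is KZ-equivalent to SOME representation `[ball × cube, c · k! · Π]`". -/
def GammaHodgeSectorExistsAtOne : Prop :=
  ∀ (N N' k : ℕ) (x y : Fin N → ℚ) (x' y' : Fin N' → ℚ),
    Admissible x y → Admissible x' y' → HodgeConditionAtOne N N' k x y x' y' →
    ∀ r : IntegralRep N, IsCubeBetaRep x y r →
      ∃ (c : ℝ) (r' : IntegralRep (2 * k + N')), IsBallCubeRep k x' y' c r' ∧ Equivalent r r'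

/-- The integrand `t^{−3/4}(1−t)^{−3/4}` of `B(¼,¼)` on `ℝ¹`. [folklore] -/
def quarterFun (t : Fin 1 → ℝ) : ℝ := (t 0) ^ (-(3 / 4 : ℝ)) * (1 - t 0) ^ (-(3 / 4 : ℝ))

/-- On `(0,1)`: `t^{−3/4}(1−t)^{−3/4} = 1/(√p · √√p)`, `p = t(1−t)`. [folklore] -/
theorem quarterFun_eq_inv_sqrt {t : Fin 1 → ℝ} (ht : t ∈ unitIntervalDomain) :
    quarterFun t =
      (Real.sqrt (t 0 * (1 - t 0)) * Real.sqrt (Real.sqrt (t 0 * (1 - t 0))))⁻¹ := by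
  rw [mem_unitIntervalDomain] at ht
  have h0 : 0 ≤ t 0 := ht.1.le
  have h1 : 0 ≤ 1 - t 0 := by linarith [ht.2]
  have hp : 0 < t 0 * (1 - t 0) := mul_pos ht.1 (by linarith [ht.2])
  rw [quarterFun, ← Real.mul_rpow h0 h1, Real.rpow_neg hp.le,
    show (3 / 4 : ℝ) = 1 / 2 + 1 / 4 by norm_num, Real.rpow_add hp, Real.sqrt_eq_rpow,
    Real.sqrt_eq_rpow, ← Real.rpow_mul hp.le]
  norm_num

/-- The `B(¼,¼)` integrand is `ℚ`-semialgebraic on `(0,1)`. [folklore] -/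
theorem isSemialgebraicFunOn_quarterFun : IsSemialgebraicFunOn ℚ unitIntervalDomain quarterFun := by
  have hW := isSemialgebraic_unitIntervalDomain
  have hx : IsSemialgebraicFunOn ℚ unitIntervalDomain (fun t => t 0) :=
    (isSemialgebraicFunOn_aeval hW (MvPolynomial.X 0)).congr fun t _ => by simp
  have h1x : IsSemialgebraicFunOn ℚ unitIntervalDomain (fun t => 1 - t 0) :=
    (isSemialgebraicFunOn_aeval hW (1 - MvPolynomial.X 0)).congr fun t _ => by simp
  have hp := hx.fun_mul h1x
  exact ((hp.fun_sqrt.fun_mul hp.fun_sqrt.fun_sqrt).fun_inv).congr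
    fun t ht => (quarterFun_eq_inv_sqrt ht).symm

/-- The `B(¼,¼)` integrand is the beta integrand `(¼,¼)` transported along `ℝ¹ ≃ ℝ`. [folklore] -/
theorem quarterFun_eq_comp :
    quarterFun = (fun x : ℝ => x ^ ((1 / 4 : ℝ) - 1) * (1 - x) ^ ((1 / 4 : ℝ) - 1)) ∘
      (MeasurableEquiv.funUnique (Fin 1) ℝ) := by
  funext t
  simp only [quarterFun, Function.comp_apply]
  rw [show ((1 / 4 : ℝ) - 1) = -(3 / 4) by norm_num]
  simp [MeasurableEquiv.funUnique]

/-- Integrability of the `B(¼,¼)` integrand on `(0,1)`. [folklore] -/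
theorem integrableOn_quarterFun : IntegrableOn quarterFun unitIntervalDomain := by
  have h := (integrableOn_betaIntegrand_and_integral_eq (α := 1 / 4) (β := 1 / 4)
    (by norm_num) (by norm_num)).1
  rw [unitIntervalDomain_eq_preimage, quarterFun_eq_comp]
  exact ((volume_preserving_funUnique (Fin 1) ℝ).integrableOn_comp_preimage
    (MeasurableEquiv.measurableEmbedding _)).mpr h

/-- `B(¼,¼) = Γ(¼)²/√π`. [folklore] -/
theorem beta_quarter_quarter :
    ProbabilityTheory.beta (1 / 4) (1 / 4) = Real.Gamma (1 / 4) ^ 2 / Real.sqrt Real.pi := by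
  rw [ProbabilityTheory.beta, show (1 / 4 : ℝ) + 1 / 4 = 1 / 2 by norm_num, Real.Gamma_one_half_eq,
    sq]

/-- `∫_{(0,1)} t^{−3/4}(1−t)^{−3/4} dt = Γ(¼)²/√π`. [folklore] -/
theorem setIntegral_quarterFun :
    ∫ t in unitIntervalDomain, quarterFun t = Real.Gamma (1 / 4) ^ 2 / Real.sqrt Real.pi := by
  have h := (integrableOn_betaIntegrand_and_integral_eq (α := 1 / 4) (β := 1 / 4)
    (by norm_num) (by norm_num)).2
  rw [beta_quarter_quarter] at h
  rw [unitIntervalDomain_eq_preimage, quarterFun_eq_comp, ← h]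
  exact (volume_preserving_funUnique (Fin 1) ℝ).setIntegral_preimage_emb
    (MeasurableEquiv.measurableEmbedding _)
    (fun x : ℝ => x ^ ((1 / 4 : ℝ) - 1) * (1 - x) ^ ((1 / 4 : ℝ) - 1)) (Ioo 0 1)

/-- The representation `[(0,1), t^{−3/4}(1−t)^{−3/4}]` of `B(¼,¼)`. [cite: KontsevichZagier2001, §1.1] -/
def quarterRep : IntegralRep 1 where
  domain := unitIntervalDomain
  integrand := quarterFun
  isSemialgebraic_domain := isSemialgebraic_unitIntervalDomain
  isSemialgebraicFunOn_integrand := isSemialgebraicFunOn_quarterFun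
  integrableOn := integrableOn_quarterFun

/-- `value quarterRep = Γ(¼)²/√π`. [folklore] -/
theorem quarterRep_value : quarterRep.value = Real.Gamma (1 / 4) ^ 2 / Real.sqrt Real.pi :=
  setIntegral_quarterFun

/-- `quarterRep` is the cube representation at `N = 1`, `x = y = ¼`. [folklore] -/
theorem isCubeBetaRep_quarterRep :
    IsCubeBetaRep (fun _ : Fin 1 => (1 / 4 : ℚ)) (fun _ => 1 / 4) quarterRep := by
  refine ⟨rfl, fun t _ => ?_⟩
  simp only [quarterRep, quarterFun, Fin.prod_univ_one]
  push_cast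
  norm_num

/-- `x = y = ¼` passes the test at `u = 1` with `k = 0`: `{¼} + {¼} − {½} = 0`. [folklore] -/
theorem hodgeConditionAtOne_quarter :
    HodgeConditionAtOne 1 0 0 (fun _ : Fin 1 => (1 / 4 : ℚ)) (fun _ => 1 / 4) Fin.elim0 Fin.elim0 := by
  have h4 : Int.fract (1 / 4 : ℚ) = 1 / 4 := Int.fract_eq_self.mpr ⟨by norm_num, by norm_num⟩
  have h2 : Int.fract (1 / 4 + 1 / 4 : ℚ) = 1 / 2 := by
    rw [show (1 / 4 + 1 / 4 : ℚ) = 1 / 2 by norm_num]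
    exact Int.fract_eq_self.mpr ⟨by norm_num, by norm_num⟩
  simp only [HodgeConditionAtOne, hodgeSum, Nat.cast_one, one_mul, Finset.univ_unique,
    Fin.default_eq_zero, Finset.sum_singleton, h4, h2, Finset.univ_eq_empty, Finset.sum_empty]
  norm_num

/-- `Γ(¼)²/√π` is transcendental — indeed `π ∉ ℚ(Γ(¼))^{alg}`: from Chudnovsky's algebraic
independence of `π` and `Γ(¼)` (tree: `algebraicIndependent_real_pi_gamma_one_quarter`). Stated
in the form used below: no algebraic `c` has `Γ(¼)²/√π = c`. [cite: Chudnovsky1984, Ch. 7 §2 Corollary 2.3] -/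
theorem not_isAlgebraic_gamma_quarter_sq_div_sqrt_pi {c : ℝ} (hc : IsAlgebraic ℚ c)
    (h : Real.Gamma (1 / 4) ^ 2 / Real.sqrt Real.pi = c) : False := by
  set γ : ℝ := Real.Gamma (1 / 4) with hγ
  have hγpos : 0 < γ := Real.Gamma_pos_of_pos (by norm_num)
  have hsqrt : 0 < Real.sqrt Real.pi := Real.sqrt_pos.mpr Real.pi_pos
  have hcpos : 0 < c := by rw [← h]; positivity
  -- `π = (c²)⁻¹ · γ⁴`
  have hpi : Real.pi = (c ^ 2)⁻¹ * γ ^ 4 := by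
    have h2 : c ^ 2 = γ ^ 4 / Real.pi := by
      rw [← h, div_pow, Real.sq_sqrt Real.pi_pos.le]; ring
    rw [h2]
    field_simp
  -- transcendence of `π` over `ℚ(γ)`
  have hind := algebraicIndependent_real_pi_gamma_one_quarter
  have hT : Transcendental (Algebra.adjoin ℚ ((![Real.pi, γ]) '' ({1} : Set (Fin 2)))) (![Real.pi, γ] 0) :=
    hind.transcendental_adjoin (s := {1}) (i := 0) (by simp)
  have himg : (![Real.pi, γ]) '' ({1} : Set (Fin 2)) = {γ} := by
    rw [image_singleton]; rfl
  rw [himg] at hT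
  have hT' : Transcendental (IntermediateField.adjoin ℚ ({γ} : Set ℝ)) Real.pi :=
    IntermediateField.transcendental_adjoin_iff.mpr hT
  -- but `π = (c²)⁻¹ γ⁴` is algebraic over `ℚ(γ)`
  set K := IntermediateField.adjoin ℚ ({γ} : Set ℝ) with hK
  have hγK : γ ∈ K := IntermediateField.mem_adjoin_simple_self ℚ γ
  have h1 : IsAlgebraic K γ := by
    simpa using isAlgebraic_algebraMap (R := K) (A := ℝ) ⟨γ, hγK⟩
  have h2 : IsAlgebraic K ((c ^ 2)⁻¹) := ((hc.pow 2).inv).tower_top K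
  have h3 : IsAlgebraic K Real.pi := by
    rw [hpi]
    exact h2.mul (h1.pow 4)
  exact hT' h3

/-- **The strengthening is FALSE: the unit quantifier of the Hodge test is essential.** Witness
`N = 1, N' = 0, k = 0`, `x = y = ¼` (admissible; passes the `u = 1` test, fails it at `u = 3`),
`r = quarterRep`: an equivalence `r ~ r'` with `r'` pinned as `[pt, c · 0! · 1]` forces (i) `c`
algebraic (§4, pinning) and (ii) `B(¼,¼) = Γ(¼)²/√π = c` (soundness, `vol ℝ⁰ = 1`), contradicting
Chudnovsky. [cite: Chudnovsky1984, Ch. 7 §2 Corollary 2.3] -/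
theorem not_gammaHodgeSectorExistsAtOne : ¬ GammaHodgeSectorExistsAtOne := by
  intro h
  have hadm : Admissible (fun _ : Fin 1 => (1 / 4 : ℚ)) (fun _ => 1 / 4) := by
    have h4 : Int.fract (1 / 4 : ℚ) = 1 / 4 := Int.fract_eq_self.mpr ⟨by norm_num, by norm_num⟩
    exact fun _ => ⟨by norm_num, by norm_num, by rw [h4]; norm_num, by rw [h4]; norm_num⟩
  obtain ⟨c, r', hr', hE⟩ := h 1 0 0 _ _ Fin.elim0 Fin.elim0 hadm admissible_elim0
    hodgeConditionAtOne_quarter quarterRep isCubeBetaRep_quarterRep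
  have halg : IsAlgebraic ℚ c := isAlgebraic_of_isBallCubeRep hr'
  change IntegralRep 0 at r'
  have hdr' : r'.domain = univ := by rw [hr'.1]; ext; simp
  have hval' : r'.value = c := by
    rw [value_dim_zero r' hdr', hr'.2 (by rw [hdr']; exact mem_univ _)]
    simp
  have hv : quarterRep.value = r'.value := Equivalent.value_eq_holds hE
  rw [quarterRep_value, hval'] at hv
  exact not_isAlgebraic_gamma_quarter_sq_div_sqrt_pi halg hv

/-- For contrast, the crux itself is untouched by the witness: with the FULL test the data
`x = y = ¼`, `N' = 0` are not in the sector at all (`reflection_sector_of_N_one` forces `k = 1`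
and `x + y ∈ ℤ`). [folklore] -/
theorem quarter_not_hodgeCondition (k : ℕ) :
    ¬ HodgeCondition 1 0 k (fun _ : Fin 1 => (1 / 4 : ℚ)) (fun _ => 1 / 4) Fin.elim0 Fin.elim0 := by
  intro hH
  have hadm : Admissible (fun _ : Fin 1 => (1 / 4 : ℚ)) (fun _ => 1 / 4) := by
    have h4 : Int.fract (1 / 4 : ℚ) = 1 / 4 := Int.fract_eq_self.mpr ⟨by norm_num, by norm_num⟩
    exact fun _ => ⟨by norm_num, by norm_num, by rw [h4]; norm_num, by rw [h4]; norm_num⟩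
  obtain ⟨-, hfr⟩ := reflection_sector_of_N_one hadm hH
  have : Int.fract ((1 / 4 : ℚ) + 1 / 4) = 1 / 2 := by
    rw [show ((1 / 4 : ℚ) + 1 / 4) = 1 / 2 by norm_num]
    exact Int.fract_eq_self.mpr ⟨by norm_num, by norm_num⟩
  rw [this] at hfr
  norm_num at hfr

end Strengthening


/-! ## §7 Tools for instances: a FINITE form of the Hodge test, and the sector contains the
triplication pair `TriplicationAccessible` (stmt-KontsevichZagierPeriods-0312)

The test quantifies over all `u ≥ 1`; it is periodic in `u` modulo any common multiple `D` of the
denominators of the `x_j, y_j, x_j + y_j` (and primed), so it reduces to `1 ≤ u ≤ D`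
(`hodgeCondition_iff_le`), after which concrete data are checked by `decide`. With it:
`GammaHodgeSector → TriplicationAccessible` (`triplicationAccessible_of_gammaHodgeSector`): the
crux at `N = 2, N' = 0, k = 1`, `x = (1/9, 5/9)`, `y = (4/9, 7/9)`, `c = 2·3^{7/6}` gives
`[(0,1)², …] ~ [unit disc, 2·3^{7/6}]` (value equality = Gauss's triplication formula, PROVED in
the tree: `GaussMultiplication.real_formula`), and one change of variables `z ↦ 2z` (`|det| = 4`)
reaches the radius-2 disc with the constant `3^{7/6}/2` of item 0312. -/

section FiniteTest

/-- Periodicity of the test sum: `hodgeSum x y (u + D·t) = hodgeSum x y u` when every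
`den x_j`, `den y_j`, `den (x_j + y_j)` divides `D`. [folklore] -/
theorem hodgeSum_add_mul {N : ℕ} {x y : Fin N → ℚ} {D : ℕ} (hx : ∀ j, (x j).den ∣ D)
    (hy : ∀ j, (y j).den ∣ D) (hxy : ∀ j, (x j + y j).den ∣ D) (u t : ℕ) :
    hodgeSum x y (u + D * t) = hodgeSum x y u := by
  have key : ∀ q : ℚ, q.den ∣ D → Int.fract (((u + D * t : ℕ) : ℚ) * q) = Int.fract ((u : ℚ) * q) := by
    intro q hq
    obtain ⟨e, he⟩ := hq
    have hDq : (D : ℚ) * q = (e : ℚ) * (q.num : ℚ) := by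
      have hnum : q * q.den = q.num := Rat.mul_den_eq_num q
      rw [he]
      push_cast
      linear_combination (e : ℚ) * hnum
    have : ((u + D * t : ℕ) : ℚ) * q = (u : ℚ) * q + ((t * e * q.num : ℤ) : ℚ) := by
      push_cast
      linear_combination (t : ℚ) * hDq
    rw [this, Int.fract_add_intCast]
  unfold hodgeSum
  refine Finset.sum_congr rfl fun j _ => ?_
  rw [key _ (hx j), key _ (hy j), key _ (hxy j)]

/-- Periodicity of the coprimality side condition. [folklore] -/
theorem coprimeDen_add_mul {N : ℕ} {x y : Fin N → ℚ} {D : ℕ} (hx : ∀ j, (x j).den ∣ D)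
    (hy : ∀ j, (y j).den ∣ D) (u t : ℕ) : CoprimeDen x y (u + D * t) ↔ CoprimeDen x y u := by
  have key : ∀ d : ℕ, d ∣ D → (Nat.Coprime (u + D * t) d ↔ Nat.Coprime u d) := by
    intro d hd
    obtain ⟨e, rfl⟩ := hd
    rw [show u + d * e * t = u + (e * t) * d by ring]
    exact Nat.coprime_add_mul_right_left u d (e * t)
  unfold CoprimeDen
  exact forall_congr' fun j => and_congr (key _ (hx j)) (key _ (hy j))

/-- `CoprimeDen` is decidable (for `decide` on concrete data). -/
instance decidableCoprimeDen {N : ℕ} (x y : Fin N → ℚ) (u : ℕ) : Decidable (CoprimeDen x y u) := by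
  unfold CoprimeDen; infer_instance

/-- **Finite form of the Hodge-type test.** If `D ≥ 1` is a common multiple of all
`den x_j, den y_j, den (x_j+y_j), den x'_l, den y'_l, den (x'_l+y'_l)`, the test over all `u ≥ 1`
is equivalent to the test over `u ∈ [1, D]` — decidable data (`decide +kernel` evaluates the
rational arithmetic). [folklore] -/
theorem hodgeCondition_iff_le {N N' k : ℕ} {x y : Fin N → ℚ} {x' y' : Fin N' → ℚ} {D : ℕ}
    (hD : 0 < D) (hx : ∀ j, (x j).den ∣ D) (hy : ∀ j, (y j).den ∣ D) (hxy : ∀ j, (x j + y j).den ∣ D)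
    (hx' : ∀ l, (x' l).den ∣ D) (hy' : ∀ l, (y' l).den ∣ D) (hxy' : ∀ l, (x' l + y' l).den ∣ D) :
    HodgeCondition N N' k x y x' y' ↔
      ∀ u ∈ Finset.Icc 1 D, CoprimeDen x y u → CoprimeDen x' y' u →
        hodgeSum x y u - hodgeSum x' y' u = (k : ℚ) := by
  constructor
  · exact fun h u hu hc hc' => h u (Finset.mem_Icc.mp hu).1 hc hc'
  · intro h u hu hc hc'
    -- reduce `u` to `u₀ = (u - 1) % D + 1 ∈ [1, D]`, `u = u₀ + D * t`
    set u₀ := (u - 1) % D + 1 with hu₀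
    have hu₀pos : 0 < u₀ := Nat.succ_pos _
    have hu₀le : u₀ ≤ D := Nat.mod_lt _ hD
    obtain ⟨t, ht⟩ : ∃ t, u = u₀ + D * t := by
      refine ⟨(u - 1) / D, ?_⟩
      have := Nat.mod_add_div (u - 1) D
      omega
    rw [ht] at hc hc' ⊢
    rw [coprimeDen_add_mul hx hy] at hc
    rw [coprimeDen_add_mul hx' hy'] at hc'
    rw [hodgeSum_add_mul hx hy hxy, hodgeSum_add_mul hx' hy' hxy']
    exact h u₀ (Finset.mem_Icc.mpr ⟨hu₀pos, hu₀le⟩) hc hc'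

end FiniteTest

section Triplication

/-- The exponent data of the triplication pair: `x = (1/9, 5/9)`. [folklore] -/
def tripX : Fin 2 → ℚ := ![1 / 9, 5 / 9]

/-- The exponent data of the triplication pair: `y = (4/9, 7/9)`. [folklore] -/
def tripY : Fin 2 → ℚ := ![4 / 9, 7 / 9]

/-- The triplication data are admissible. [folklore] -/
theorem admissible_trip : Admissible tripX tripY := by
  intro j
  fin_cases j <;> simp [tripX, tripY] <;> norm_num [Int.fract_eq_iff]

/-- **The triplication data pass the full Hodge-type test with `k = 1`** (`N = 2`, `N' = 0`;
reduced to `u ≤ 9` by `hodgeCondition_iff_le`, then `decide`). [folklore] -/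
theorem hodgeCondition_trip : HodgeCondition 2 0 1 tripX tripY Fin.elim0 Fin.elim0 := by
  rw [hodgeCondition_iff_le (D := 9) (by norm_num) (by decide +kernel) (by decide +kernel)
    (by decide +kernel) (fun l => l.elim0) (fun l => l.elim0) (fun l => l.elim0)]
  decide +kernel

/-- The Deligne constant of the triplication pair: `c = 2·3^{7/6}`
(`B(1/9,4/9)·B(5/9,7/9) = c·π`). [folklore] -/
def tripConst : ℝ := 2 * (3 : ℝ) ^ ((7 : ℝ) / 6)

/-- `2·3^{7/6}` is algebraic. [folklore] -/
theorem isAlgebraic_tripConst : IsAlgebraic ℚ tripConst := by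
  have h := KoblitzOgus.isAlgebraic_nat_rpow_rat (m := 3) (by norm_num) 7 (q := 6) (by norm_num)
  have h' : ((3 : ℕ) : ℝ) ^ (((7 : ℤ) : ℝ) / (6 : ℕ)) = (3 : ℝ) ^ ((7 : ℝ) / 6) := by norm_num
  rw [h'] at h
  exact (isAlgebraic_nat 2).mul h

/-- `tripConst > 0`. [folklore] -/
theorem tripConst_pos : 0 < tripConst := by
  unfold tripConst; positivity

/-- The unit-disc representation `[open unit disc, c]` with an algebraic constant `c`. [folklore] -/
def constDiscRep (c : ℝ) (hc : IsAlgebraic ℚ c) : IntegralRep 2 where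
  domain := unitDisc
  integrand := fun _ => c
  isSemialgebraic_domain := isSemialgebraic_unitDisc
  isSemialgebraicFunOn_integrand := isSemialgebraicFunOn_const_of_isAlgebraic isSemialgebraic_unitDisc hc
  integrableOn := integrableOn_const (by simp [volume_unitDisc])

/-- `value [unit disc, c] = π·c`. [folklore] -/
theorem constDiscRep_value (c : ℝ) (hc : IsAlgebraic ℚ c) : (constDiscRep c hc).value = Real.pi * c := by
  rw [IntegralRep.value, show (constDiscRep c hc).domain = unitDisc from rfl,
    show (constDiscRep c hc).integrand = fun _ => c from rfl, setIntegral_const, measureReal_def,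
    volume_unitDisc, ENNReal.toReal_ofReal Real.pi_pos.le, smul_eq_mul]

/-- `[unit disc, c]` is the ball × cube representation at `k = 1`, `N' = 0`. [folklore] -/
theorem isBallCubeRep_constDiscRep (c : ℝ) (hc : IsAlgebraic ℚ c) :
    IsBallCubeRep (N' := 0) 1 Fin.elim0 Fin.elim0 c (constDiscRep c hc) := by
  refine ⟨?_, fun z _ => ?_⟩
  · ext z
    simp [constDiscRep, unitDisc, Fin.sum_univ_two]
  · simp [constDiscRep]

/-- **Gauss's triplication, Beta form**: `B(1/9,4/9)·B(5/9,7/9) = 2·3^{7/6}·π` (from the tree's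
`GaussMultiplication.real_formula` at `n = 3`, `x = 1/9`, and `Γ(4/3) = Γ(1/3)/3`).
[cite: AndrewsAskeyRoy1999, Thm 1.5.2] -/
theorem beta_trip :
    ProbabilityTheory.beta (1 / 9) (4 / 9) * ProbabilityTheory.beta (5 / 9) (7 / 9) =
      Real.pi * tripConst := by
  have h3 : (3 : ℕ) ≠ 0 := by norm_num
  have hG := Literature.Analysis.SpecialFunctions.GaussMultiplication.real_formula h3
    (x := 1 / 9) (by norm_num)
  norm_num [Literature.Analysis.SpecialFunctions.GaussMultiplication.prodGamma,
    Finset.prod_range_succ, Finset.prod_range_zero] at hG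
  -- hG : Γ(1/9) Γ(4/9) Γ(7/9) · 3^(1/3) = Γ(1/3) √3 (2π)
  have h43 : Real.Gamma (4 / 3) = 1 / 3 * Real.Gamma (1 / 3) := by
    rw [show (4 / 3 : ℝ) = 1 / 3 + 1 by norm_num, Real.Gamma_add_one (by norm_num)]
  have h76 : (3 : ℝ) ^ ((7 : ℝ) / 6) * (3 : ℝ) ^ ((1 : ℝ) / 3) = 3 * Real.sqrt 3 := by
    rw [← Real.rpow_add (by norm_num : (0 : ℝ) < 3), show ((7 : ℝ) / 6 + 1 / 3) = 1 + 1 / 2 by norm_num,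
      Real.rpow_add (by norm_num : (0 : ℝ) < 3), Real.rpow_one, Real.sqrt_eq_rpow]
  have hΓ59 : Real.Gamma (5 / 9) ≠ 0 := (Real.Gamma_pos_of_pos (by norm_num)).ne'
  have hΓ13 : Real.Gamma (1 / 3) ≠ 0 := (Real.Gamma_pos_of_pos (by norm_num)).ne'
  have hc3 : (3 : ℝ) ^ ((1 : ℝ) / 3) ≠ 0 := (Real.rpow_pos_of_pos (by norm_num) _).ne'
  -- `A · 3 = 2π · 3^{7/6} · Γ(1/3)` for `A = Γ(1/9)Γ(4/9)Γ(7/9)`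
  have key : Real.Gamma (1 / 9) * Real.Gamma (4 / 9) * Real.Gamma (7 / 9) * 3 =
      2 * Real.pi * (3 : ℝ) ^ ((7 : ℝ) / 6) * Real.Gamma (1 / 3) := by
    refine mul_right_cancel₀ hc3 ?_
    linear_combination (3 : ℝ) * hG - 2 * Real.pi * Real.Gamma (1 / 3) * h76
  rw [ProbabilityTheory.beta, ProbabilityTheory.beta, show (1 / 9 + 4 / 9 : ℝ) = 5 / 9 by norm_num,
    show (5 / 9 + 7 / 9 : ℝ) = 4 / 3 by norm_num, h43, tripConst]
  field_simp
  linear_combination key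

/-- The open unit square of the triplication pair is the product set `(0,1)²`. [folklore] -/
theorem setOf_forall_mem_Ioo_eq_pi :
    {x : Fin 2 → ℝ | ∀ i, x i ∈ Ioo (0:ℝ) 1} = Set.pi univ fun _ => Ioo (0:ℝ) 1 := by
  ext x; simp

/-- **Value of the cube representation of the triplication pair** (Fubini on `(0,1)²` and the two
beta integrals): `value r = B(1/9,4/9)·B(5/9,7/9)`. [folklore] -/
theorem value_trip_cube (r : IntegralRep 2) (hd : r.domain = {x | ∀ i, x i ∈ Ioo (0:ℝ) 1})
    (hi : EqOn r.integrand (fun x => (x 0) ^ (-(8:ℝ)/9) * (1 - x 0) ^ (-(5:ℝ)/9) *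
      (x 1) ^ (-(4:ℝ)/9) * (1 - x 1) ^ (-(2:ℝ)/9)) r.domain) :
    r.value = ProbabilityTheory.beta (1 / 9) (4 / 9) * ProbabilityTheory.beta (5 / 9) (7 / 9) := by
  -- the two one-variable factors
  set g : Fin 2 → ℝ → ℝ := ![fun t => t ^ (-(8:ℝ)/9) * (1 - t) ^ (-(5:ℝ)/9),
    fun t => t ^ (-(4:ℝ)/9) * (1 - t) ^ (-(2:ℝ)/9)] with hg
  have h1 := integrableOn_betaIntegrand_and_integral_eq (α := 1 / 9) (β := 4 / 9)
    (by norm_num) (by norm_num)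
  have h2 := integrableOn_betaIntegrand_and_integral_eq (α := 5 / 9) (β := 7 / 9)
    (by norm_num) (by norm_num)
  have hg0 : (fun x : ℝ => x ^ ((1 / 9 : ℝ) - 1) * (1 - x) ^ ((4 / 9 : ℝ) - 1)) = g 0 := by
    funext t; simp only [hg, Matrix.cons_val_zero]; norm_num
  have hg1 : (fun x : ℝ => x ^ ((5 / 9 : ℝ) - 1) * (1 - x) ^ ((7 / 9 : ℝ) - 1)) = g 1 := by
    funext t; simp only [hg, Matrix.cons_val_one]; norm_num
  rw [hg0] at h1
  rw [hg1] at h2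
  have hF : EqOn r.integrand (fun x => ∏ k, g k (x k)) r.domain := by
    intro x hx
    rw [hi hx]
    simp only [Fin.prod_univ_two, hg, Matrix.cons_val_zero, Matrix.cons_val_one]
    ring
  rw [IntegralRep.value, setIntegral_congr_fun (IntegralRep.measurableSet_domain_holds r) hF, hd,
    setOf_forall_mem_Ioo_eq_pi]
  have hrestr : (volume : Measure (Fin 2 → ℝ)).restrict (Set.pi univ fun _ => Ioo (0 : ℝ) 1) =
      Measure.pi fun _ : Fin 2 => (volume : Measure ℝ).restrict (Ioo 0 1) := by
    rw [volume_pi]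
    exact Measure.restrict_pi_pi _ _
  rw [hrestr, integral_fintype_prod_eq_prod g, Fin.prod_univ_two, h1.2, h2.2]

/-- **Scaling move**: `[unit disc, 2·3^{7/6}] ~ [disc of radius 2, 3^{7/6}/2]`, one change of
variables `z ↦ 2z`, `|det| = 4` (rule 2). [cite: KontsevichZagier2001, §1.2 rule (2)] -/
theorem equivalent_constDisc_radiusTwo (r' : IntegralRep 2) (hd' : r'.domain = {x | x 0 ^ 2 + x 1 ^ 2 < 4})
    (hi' : EqOn r'.integrand (fun _ => (3:ℝ) ^ ((7:ℝ)/6) / 2) r'.domain) :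
    Equivalent (constDiscRep tripConst isAlgebraic_tripConst) r' := by
  set R := constDiscRep tripConst isAlgebraic_tripConst with hR
  set Φ : (Fin 2 → ℝ) → (Fin 2 → ℝ) := fun x => (2 : ℝ) • x with hΦ
  set Φ' : (Fin 2 → ℝ) → (Fin 2 → ℝ) →L[ℝ] (Fin 2 → ℝ) :=
    fun _ => (2 : ℝ) • ContinuousLinearMap.id ℝ (Fin 2 → ℝ) with hΦ'
  have hdomR : R.domain = unitDisc := rfl
  have himage : r'.domain = Φ '' R.domain := by
    rw [hd', hdomR]
    ext y
    simp only [mem_setOf_eq, mem_image, unitDisc, hΦ]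
    constructor
    · intro hy
      refine ⟨(1 / 2 : ℝ) • y, ?_, ?_⟩
      · simp only [Pi.smul_apply, smul_eq_mul]
        nlinarith
      · ext j
        simp
    · rintro ⟨x, hx, rfl⟩
      simp only [Pi.smul_apply, smul_eq_mul]
      nlinarith
  have hdet : ∀ x, |(Φ' x).det| = 4 := by
    intro x
    simp only [hΦ', ContinuousLinearMap.det, ContinuousLinearMap.toLinearMap_smul, ContinuousLinearMap.coe_id,
      LinearMap.det_smul, LinearMap.det_id, Module.finrank_fin_fun, mul_one]
    norm_num
  have hmem : KZ.of R - KZ.of r' ∈ changeOfVariablesRel := by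
    refine ⟨2, R, r', Φ, Φ', ?_, ?_, ?_, himage, ?_, rfl⟩
    · refine (isSemialgebraicMapOn_aeval isSemialgebraic_unitDisc
        (fun j => 2 * MvPolynomial.X j : Fin 2 → MvPolynomial (Fin 2) ℚ)).congr fun x _ => ?_
      ext j
      simp [hΦ]
    · intro x _
      have h := ((hasFDerivAt_id (𝕜 := ℝ) x).const_smul (2 : ℝ)).hasFDerivWithinAt (s := R.domain)
      simpa [hΦ, hΦ'] using h
    · intro a _ b _ hab
      exact smul_right_injective (Fin 2 → ℝ) (two_ne_zero (α := ℝ)) hab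
    · intro x hx
      have hΦx : Φ x ∈ r'.domain := by rw [himage]; exact mem_image_of_mem Φ hx
      rw [hi' hΦx, hdet x]
      simp only [hR, constDiscRep, tripConst]
      ring
  exact changeOfVariablesRel_subset_relations hmem

/-- The triplication integrand in the crux's product form. [folklore] -/
theorem isCubeBetaRep_trip (r : IntegralRep 2) (hd : r.domain = {x | ∀ i, x i ∈ Ioo (0:ℝ) 1})
    (hi : EqOn r.integrand (fun x => (x 0) ^ (-(8:ℝ)/9) * (1 - x 0) ^ (-(5:ℝ)/9) *
      (x 1) ^ (-(4:ℝ)/9) * (1 - x 1) ^ (-(2:ℝ)/9)) r.domain) : IsCubeBetaRep tripX tripY r := by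
  refine ⟨hd, fun t ht => ?_⟩
  rw [hi ht]
  simp only [Fin.prod_univ_two, tripX, tripY, Matrix.cons_val_zero, Matrix.cons_val_one]
  push_cast
  norm_num [mul_assoc]

open Summit.KontsevichZagierPeriods.KontsevichZagierPeriods.Theses.TerasomaMultiplication (TriplicationAccessible) in
/-- **The Γ-Hodge sector contains the triplication pair** (stmt-KontsevichZagierPeriods-0312,
shared by Neg / ExpConservative / MultivaluedCoV / FermatIsogeny / CyclesAsDomains / ZeroPortrait /
TerasomaMultiplication): `GammaHodgeSector → TriplicationAccessible`. The crux at
`(N, N', k) = (2, 0, 1)`, `x = (1/9, 5/9)`, `y = (4/9, 7/9)` (Hodge test: `hodgeCondition_trip`,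
by `decide +kernel` after `hodgeCondition_iff_le`), `c = 2·3^{7/6}` (value equality = Gauss
triplication, `beta_trip` + Fubini `value_trip_cube`) gives `r ~ [unit disc, 2·3^{7/6}]`, and the
scaling move `equivalent_constDisc_radiusTwo` finishes. Positive glue — evidence for provers, not
landed by the refuter. [folklore] -/
theorem triplicationAccessible_of_gammaHodgeSector (h : GammaHodgeSector) : TriplicationAccessible := by
  intro r r' hd hi hd' hi'
  set R := constDiscRep tripConst isAlgebraic_tripConst with hR
  have hv : r.value = R.value := by
    rw [value_trip_cube r hd hi, beta_trip, hR, constDiscRep_value]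
  have h1 : Equivalent r R :=
    gammaHodgeSector_iff.mp h 2 0 1 tripX tripY Fin.elim0 Fin.elim0 tripConst admissible_trip
      admissible_elim0 hodgeCondition_trip isAlgebraic_tripConst r R (isCubeBetaRep_trip r hd hi)
      (isBallCubeRep_constDiscRep tripConst isAlgebraic_tripConst) hv
  exact h1.trans (equivalent_constDisc_radiusTwo r' hd' hi')

end Triplication


/-! ### The two "deep" instances proposed as targets by triage r1 (SketchIdeator3:
`DasDeepThirtyThree`, `DasDeepThirtyFive`) — certified Hodge type, and summit-implied

Both are typed with `r.value = r'.value` and `IsAlgebraic ℚ c` as HYPOTHESES, so each is an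
instance of `KZPeriodConjecture'`: summit-implied (`core_of_summit`), not killable by the
disprover short of `¬` summit; a "Neg-type invariant separating the pair" IS a refutation of
Conjecture 1. What the disprover can certify is that they lie IN the sector: the full Hodge test
holds (finite form, `decide +kernel`). -/

section DeepInstances

/-- Level-33 deep data: `x = (1/33, 2/33)`, `y = (1/33, 2/3)` versus `x' = (1/33, 2/33)`,
`y' = (1/11, 14/33)`, `k = 0` (`B(1/33,1/33)B(2/33,2/3) = c·B(1/33,1/11)B(2/33,14/33)`). [folklore] -/
theorem hodgeCondition_deep33 :
    HodgeCondition 2 2 0 ![1 / 33, 2 / 33] ![1 / 33, 2 / 3] ![1 / 33, 2 / 33] ![1 / 11, 14 / 33] := by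
  rw [hodgeCondition_iff_le (D := 33) (by norm_num) (by decide +kernel) (by decide +kernel)
    (by decide +kernel) (by decide +kernel) (by decide +kernel) (by decide +kernel)]
  decide +kernel

/-- Level-35 deep data: `x = (4/35, 7/35, 9/35)`, `y = (32/35, 27/35, 5/7)` versus `x' = y' = 1/35`,
`k = 1` (`B(4/35,32/35)B(7/35,27/35)B(9/35,25/35) = c·π·B(1/35,1/35)`). [folklore] -/
theorem hodgeCondition_deep35 :
    HodgeCondition 3 1 1 ![4 / 35, 7 / 35, 9 / 35] ![32 / 35, 27 / 35, 5 / 7] ![1 / 35] ![1 / 35] := by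
  rw [hodgeCondition_iff_le (D := 35) (by norm_num) (by decide +kernel) (by decide +kernel)
    (by decide +kernel) (by decide +kernel) (by decide +kernel) (by decide +kernel)]
  decide +kernel

end DeepInstances


/-! ### `DasGapTwelve` (stmt-KontsevichZagierPeriods-13215) is the sector's instance
`(N, N', k) = (1, 1, 0)`, `x = 1/12, y = 1/4`, `x' = y' = 1/4`, `c = c₀` — modulo ONE classical value
identity

`GammaHodgeSector → DasGapTwelve` (`dasGapTwelve_of_gammaHodgeSector'`), with
`c₀ = 2^{−1/4}3^{3/8}√(1+√3)`: the Hodge test (`D = 12`, `decide +kernel`), admissibility,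
algebraicity of `c₀`, the two pinnings, AND the Chowla–Selberg / Vidunas value identity
`B(1/12,1/4) = c₀·B(1/4,1/4)` (`beta_das`, from the tree's Gauss multiplication at `n = 2, 3` and
Euler reflection at `5/12, 1/4, 1/3`, by polynomial elimination — `gamma_one_twelfth_sq`) are all
proved. No extra move is needed: the crux's `r'` at `k = 0, N' = 1` IS the representation of 13215. -/

section DasGap

/-- `c₀ = 2^{−1/4}·3^{3/8}·√(1+√3) = 2.0984921908…`, the constant of `DasGapTwelve`. [folklore] -/
def dasConst : ℝ := (2:ℝ) ^ (-(1:ℝ)/4) * (3:ℝ) ^ ((3:ℝ)/8) * Real.sqrt (1 + Real.sqrt 3)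

/-- `c₀` is algebraic. [folklore] -/
theorem isAlgebraic_dasConst : IsAlgebraic ℚ dasConst := by
  have h2 := KoblitzOgus.isAlgebraic_nat_rpow_rat (m := 2) (by norm_num) (-1) (q := 4) (by norm_num)
  have h2' : ((2 : ℕ) : ℝ) ^ (((-1 : ℤ) : ℝ) / (4 : ℕ)) = (2 : ℝ) ^ (-(1:ℝ)/4) := by norm_num
  rw [h2'] at h2
  have h3 := KoblitzOgus.isAlgebraic_nat_rpow_rat (m := 3) (by norm_num) 3 (q := 8) (by norm_num)
  have h3' : ((3 : ℕ) : ℝ) ^ (((3 : ℤ) : ℝ) / (8 : ℕ)) = (3 : ℝ) ^ ((3:ℝ)/8) := by norm_num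
  rw [h3'] at h3
  have hs3 : IsAlgebraic ℚ (Real.sqrt 3) := by
    refine IsAlgebraic.of_pow two_pos ?_
    rw [Real.sq_sqrt (by norm_num : (0:ℝ) ≤ 3)]
    exact isAlgebraic_nat 3
  have hs : IsAlgebraic ℚ (Real.sqrt (1 + Real.sqrt 3)) := by
    refine IsAlgebraic.of_pow two_pos ?_
    rw [Real.sq_sqrt (by positivity)]
    exact isAlgebraic_one.add hs3
  exact (h2.mul h3).mul hs

/-- The `DasGapTwelve` data pass the full Hodge-type test with `k = 0` (`D = 12`). [folklore] -/
theorem hodgeCondition_das :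
    HodgeCondition 1 1 0 ![1 / 12] ![1 / 4] ![1 / 4] ![1 / 4] := by
  rw [hodgeCondition_iff_le (D := 12) (by norm_num) (by decide +kernel) (by decide +kernel)
    (by decide +kernel) (by decide +kernel) (by decide +kernel) (by decide +kernel)]
  decide +kernel

/-- The value of a representation pinned on `(0,1) ⊆ ℝ¹` with a beta integrand (transport of the
one-variable beta integral). [folklore] -/
theorem value_of_beta_pinned (ρ : IntegralRep 1) {α β : ℝ} (hα : 0 < α) (hβ : 0 < β) (C : ℝ)
    (hd : ρ.domain = {x | x 0 ∈ Ioo (0:ℝ) 1})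
    (hi : EqOn ρ.integrand (fun x => C * ((x 0) ^ (α - 1) * (1 - x 0) ^ (β - 1))) ρ.domain) :
    ρ.value = C * ProbabilityTheory.beta α β := by
  have h := (integrableOn_betaIntegrand_and_integral_eq hα hβ).2
  have hdom : ρ.domain = (MeasurableEquiv.funUnique (Fin 1) ℝ) ⁻¹' Ioo 0 1 := by
    rw [hd]; ext t; simp [MeasurableEquiv.funUnique]
  rw [IntegralRep.value, setIntegral_congr_fun (IntegralRep.measurableSet_domain_holds ρ) hi,
    integral_const_mul, hdom, ← h]
  congr 1
  exact (volume_preserving_funUnique (Fin 1) ℝ).setIntegral_preimage_emb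
    (MeasurableEquiv.measurableEmbedding _)
    (fun x : ℝ => x ^ (α - 1) * (1 - x) ^ (β - 1)) (Ioo 0 1)

/-- `sin(5π/12) = √2(√3+1)/4` (`5π/12 = π/4 + π/6`). [folklore] -/
theorem sin_five_pi_div_twelve : Real.sin (Real.pi * (5 / 12)) = Real.sqrt 2 * (Real.sqrt 3 + 1) / 4 := by
  rw [show Real.pi * (5 / 12) = Real.pi / 4 + Real.pi / 6 by ring, Real.sin_add, Real.sin_pi_div_four,
    Real.cos_pi_div_four, Real.sin_pi_div_six, Real.cos_pi_div_six]
  ring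

/-- **`Γ(1/12)` in terms of `Γ(1/4)`, `Γ(1/3)`** (squared form):
`Γ(1/12)²·π·3^{1/4} = 6·sin(5π/12)·Γ(1/4)²·Γ(1/3)²` — from the tree's Gauss multiplication
(`GaussMultiplication.real_formula` at `n = 3, x = 1/12` and `n = 2, x = 1/12, 1/6`) and Euler
reflection at `5/12, 1/4, 1/3` (Mathlib), by polynomial elimination of `Γ(5/12), Γ(7/12), Γ(3/4),
Γ(2/3), Γ(1/6)`. [cite: AndrewsAskeyRoy1999, Thm 1.5.2] -/
theorem gamma_one_twelfth_sq :
    Real.Gamma (1 / 12) ^ 2 * Real.pi * (3:ℝ) ^ ((1:ℝ)/4) =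
      6 * Real.sin (Real.pi * (5 / 12)) * Real.Gamma (1 / 4) ^ 2 * Real.Gamma (1 / 3) ^ 2 := by
  have hT := Literature.Analysis.SpecialFunctions.GaussMultiplication.real_formula
    (n := 3) (by norm_num) (x := 1 / 12) (by norm_num)
  have hD1 := Literature.Analysis.SpecialFunctions.GaussMultiplication.real_formula
    (n := 2) (by norm_num) (x := 1 / 12) (by norm_num)
  have hD2 := Literature.Analysis.SpecialFunctions.GaussMultiplication.real_formula
    (n := 2) (by norm_num) (x := 1 / 6) (by norm_num)
  norm_num [Literature.Analysis.SpecialFunctions.GaussMultiplication.prodGamma,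
    Finset.prod_range_succ, Finset.prod_range_zero] at hT hD1 hD2
  have hR1 := Real.Gamma_mul_Gamma_one_sub (5 / 12 : ℝ)
  have hR2 := Real.Gamma_mul_Gamma_one_sub (1 / 4 : ℝ)
  have hR3 := Real.Gamma_mul_Gamma_one_sub (1 / 3 : ℝ)
  norm_num at hR1 hR2 hR3
  rw [show Real.pi * (1 / 4) = Real.pi / 4 by ring, Real.sin_pi_div_four] at hR2
  rw [show Real.pi * (1 / 3) = Real.pi / 3 by ring, Real.sin_pi_div_three] at hR3
  -- names
  set A := Real.Gamma (1 / 12) with hA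
  set B5 := Real.Gamma (5 / 12)
  set B7 := Real.Gamma (7 / 12)
  set P := Real.Gamma (1 / 4)
  set P3 := Real.Gamma (3 / 4)
  set Q := Real.Gamma (1 / 3)
  set Q2 := Real.Gamma (2 / 3)
  set G6 := Real.Gamma (1 / 6)
  set t := (3:ℝ) ^ ((1:ℝ) / 4) with ht
  set s := (2:ℝ) ^ ((1:ℝ) / 6) with hs
  set r2 := Real.sqrt 2 with hr2
  set r3 := Real.sqrt 3 with hr3
  set w := (2 * Real.pi) ^ ((1:ℝ) / 2) with hw
  set σ := Real.sin (Real.pi * (5 / 12)) with hσ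
  -- radical facts
  have hr2sq : r2 ^ 2 = 2 := Real.sq_sqrt (by norm_num)
  have hr3sq : r3 ^ 2 = 3 := Real.sq_sqrt (by norm_num)
  have hs3 : s ^ 3 = r2 := by
    rw [hs, hr2, ← Real.rpow_natCast, ← Real.rpow_mul (by norm_num), Real.sqrt_eq_rpow]; norm_num
  have hs2 : (2:ℝ) ^ ((1:ℝ) / 3) = s ^ 2 := by
    rw [hs, ← Real.rpow_natCast, ← Real.rpow_mul (by norm_num)]; norm_num
  have hw2 : w ^ 2 = 2 * Real.pi := by
    rw [hw, ← Real.sqrt_eq_rpow, Real.sq_sqrt (by positivity)]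
  have hσ0 : σ ≠ 0 := by
    rw [hσ, sin_five_pi_div_twelve]; positivity
  have hr2ne : r2 ≠ 0 := by rw [hr2]; positivity
  have h2π : (2 : ℝ) * Real.pi ≠ 0 := by positivity
  rw [hs2] at hD2
  -- reflections in polynomial form
  have hR1' : B5 * B7 * σ = Real.pi := (eq_div_iff hσ0).mp hR1
  have hR2' : P * P3 * r2 = 2 * Real.pi := by
    have := (eq_div_iff (by positivity : Real.sqrt 2 / 2 ≠ 0)).mp hR2
    linear_combination 2 * this
  have hR3' : Q * Q2 * r3 = 2 * Real.pi := by
    have := (eq_div_iff (by positivity : Real.sqrt 3 / 2 ≠ 0)).mp hR3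
    linear_combination 2 * this
  -- elimination
  have E1 : A * B5 * t = r3 * r2 * P ^ 2 :=
    mul_left_cancel₀ h2π (by linear_combination (P * r2) * hT - (A * B5 * t) * hR2')
  have E2a : A * B7 * s ^ 3 * Q2 = 4 * Real.pi * Q := by
    linear_combination (Q2 * s ^ 2) * hD1 + (r2 * w) * hD2 + (Q * w ^ 2) * hr2sq + (2 * Q) * hw2
  have E2 : r2 * A * B7 = 2 * r3 * Q ^ 2 :=
    mul_left_cancel₀ h2π (by linear_combination (Q * r3) * E2a - (A * B7 * s ^ 3) * hR3' - (2 * Real.pi * A * B7) * hs3)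
  exact mul_left_cancel₀ hr2ne (by
    linear_combination (-(A ^ 2 * t * r2)) * hR1' + (σ * A * B7 * r2) * E1 + (σ * r3 * r2 * P ^ 2) * E2
      + (2 * σ * r2 * P ^ 2 * Q ^ 2) * hr3sq)

/-- `c₀² · 3^{1/4} = 6·sin(5π/12)` (radical bookkeeping). [folklore] -/
theorem dasConst_sq_mul : dasConst ^ 2 * (3:ℝ) ^ ((1:ℝ)/4) = 6 * Real.sin (Real.pi * (5 / 12)) := by
  rw [sin_five_pi_div_twelve]
  have h2 : ((2:ℝ) ^ (-(1:ℝ)/4)) ^ 2 = (Real.sqrt 2)⁻¹ := by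
    rw [← Real.rpow_natCast, ← Real.rpow_mul (by norm_num), Real.sqrt_eq_rpow, ← Real.rpow_neg (by norm_num)]
    norm_num
  have h3 : ((3:ℝ) ^ ((3:ℝ)/8)) ^ 2 * (3:ℝ) ^ ((1:ℝ)/4) = 3 := by
    rw [← Real.rpow_natCast, ← Real.rpow_mul (by norm_num), ← Real.rpow_add (by norm_num)]
    norm_num
  have hq : (Real.sqrt (1 + Real.sqrt 3)) ^ 2 = 1 + Real.sqrt 3 := Real.sq_sqrt (by positivity)
  have hr2sq : Real.sqrt 2 ^ 2 = 2 := Real.sq_sqrt (by norm_num)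
  have hr2ne : Real.sqrt 2 ≠ 0 := by positivity
  calc dasConst ^ 2 * (3:ℝ) ^ ((1:ℝ)/4)
      = ((2:ℝ) ^ (-(1:ℝ)/4)) ^ 2 * (((3:ℝ) ^ ((3:ℝ)/8)) ^ 2 * (3:ℝ) ^ ((1:ℝ)/4)) *
          (Real.sqrt (1 + Real.sqrt 3)) ^ 2 := by unfold dasConst; ring
    _ = (Real.sqrt 2)⁻¹ * 3 * (1 + Real.sqrt 3) := by rw [h2, h3, hq]
    _ = Real.sqrt 2 * (Real.sqrt 3 + 1) / 4 * 6 := by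
          field_simp
          linear_combination (-6 * (1 + Real.sqrt 3)) * hr2sq
    _ = 6 * (Real.sqrt 2 * (Real.sqrt 3 + 1) / 4) := by ring

/-- **The value identity of `DasGapTwelve`, PROVED**: `B(1/12,1/4) = c₀·B(1/4,1/4)` with
`c₀ = 2^{−1/4}3^{3/8}√(1+√3)` (Chowla–Selberg at `d = −3, −4`; Vidunas' closed form of `Γ(1/12)`),
from `gamma_one_twelfth_sq` by taking positive square roots. [folklore] -/
theorem beta_das : ProbabilityTheory.beta (1 / 12) (1 / 4) = dasConst * ProbabilityTheory.beta (1 / 4) (1 / 4) := by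
  have hsq := gamma_one_twelfth_sq
  have hc := dasConst_sq_mul
  have htpos : 0 < (3:ℝ) ^ ((1:ℝ) / 4) := Real.rpow_pos_of_pos (by norm_num) _
  have hA : 0 < Real.Gamma (1 / 12) := Real.Gamma_pos_of_pos (by norm_num)
  have hP : 0 < Real.Gamma (1 / 4) := Real.Gamma_pos_of_pos (by norm_num)
  have hQ : 0 < Real.Gamma (1 / 3) := Real.Gamma_pos_of_pos (by norm_num)
  have hc0 : 0 < dasConst := by unfold dasConst; positivity
  -- `Γ(1/12)² π = c₀² Γ(1/4)² Γ(1/3)²`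
  have key : Real.Gamma (1 / 12) ^ 2 * Real.pi =
      dasConst ^ 2 * Real.Gamma (1 / 4) ^ 2 * Real.Gamma (1 / 3) ^ 2 := by
    refine mul_right_cancel₀ htpos.ne' ?_
    linear_combination hsq - (Real.Gamma (1 / 4) ^ 2 * Real.Gamma (1 / 3) ^ 2) * hc
  have key2 : (Real.Gamma (1 / 12) * Real.sqrt Real.pi) ^ 2 =
      (dasConst * Real.Gamma (1 / 4) * Real.Gamma (1 / 3)) ^ 2 := by
    rw [mul_pow, Real.sq_sqrt Real.pi_pos.le, key]; ring
  have key3 : Real.Gamma (1 / 12) * Real.sqrt Real.pi = dasConst * Real.Gamma (1 / 4) * Real.Gamma (1 / 3) :=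
    (pow_left_inj₀ (by positivity) (by positivity) two_ne_zero).mp key2
  rw [ProbabilityTheory.beta, ProbabilityTheory.beta, show (1 / 12 + 1 / 4 : ℝ) = 1 / 3 by norm_num,
    show (1 / 4 + 1 / 4 : ℝ) = 1 / 2 by norm_num, Real.Gamma_one_half_eq]
  have hsp : Real.sqrt Real.pi ≠ 0 := (Real.sqrt_pos.mpr Real.pi_pos).ne'
  field_simp
  linear_combination key3

open Summit.KontsevichZagierPeriods.KontsevichZagierPeriods.Theses.TerasomaMultiplication (DasGapTwelve) in
/-- **`DasGapTwelve` from the crux, modulo the value identity** `B(1/12,1/4) = c₀·B(1/4,1/4)`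
(Chowla–Selberg at `d = −3, −4` / Vidunas' closed form of `Γ(1/12)`; the only non-formal input —
left as a hypothesis). Everything else (Hodge test, admissibility, algebraicity of `c₀`, the two
pinnings, value bookkeeping) is proved; no move is needed beyond the crux instance. [folklore] -/
theorem dasGapTwelve_of_gammaHodgeSector (h : GammaHodgeSector)
    (hval : ProbabilityTheory.beta (1 / 12) (1 / 4) = dasConst * ProbabilityTheory.beta (1 / 4) (1 / 4)) :
    DasGapTwelve := by
  intro r r' hd hi hd' hi'
  have hfr : ∀ q : ℚ, 0 < q → q < 1 → Int.fract q ≠ 0 := fun q h0 h1 => by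
    rw [Int.fract_eq_self.mpr ⟨h0.le, h1⟩]; exact h0.ne'
  have hadm : Admissible ![(1 / 12 : ℚ)] ![1 / 4] := fun j => by
    fin_cases j
    exact ⟨by norm_num, by norm_num, hfr _ (by norm_num) (by norm_num), hfr _ (by norm_num) (by norm_num)⟩
  have hadm' : Admissible ![(1 / 4 : ℚ)] ![1 / 4] := fun j => by
    fin_cases j
    exact ⟨by norm_num, by norm_num, hfr _ (by norm_num) (by norm_num), hfr _ (by norm_num) (by norm_num)⟩
  -- the two pinnings
  have hr : IsCubeBetaRep ![(1 / 12 : ℚ)] ![1 / 4] r := by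
    refine ⟨?_, fun t ht => ?_⟩
    · rw [hd]; ext t; simp [Fin.forall_fin_one]
    · rw [hi ht]
      simp only [Fin.prod_univ_one, Matrix.cons_val_zero]
      push_cast
      norm_num
  have hr' : IsBallCubeRep (N' := 1) 0 ![(1 / 4 : ℚ)] ![1 / 4] dasConst r' := by
    refine ⟨?_, fun z hz => ?_⟩
    · rw [hd']; ext z; simp
    · rw [hi' hz]
      simp only [Fin.prod_univ_one, Matrix.cons_val_zero, Nat.factorial_zero, Nat.cast_one, mul_one,
        dasConst]
      have : (Fin.natAdd (2 * 0) (0 : Fin 1) : Fin (2 * 0 + 1)) = 0 := by decide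
      simp only [this]
      push_cast
      norm_num [mul_assoc]
  -- values
  have hv : r.value = r'.value := by
    have h1 := value_of_beta_pinned r (α := 1 / 12) (β := 1 / 4) (by norm_num) (by norm_num) 1 hd
      (fun t ht => by rw [hi ht]; norm_num)
    have h2 := value_of_beta_pinned r' (α := 1 / 4) (β := 1 / 4) (by norm_num) (by norm_num) dasConst hd'
      (fun t ht => by rw [hi' ht, dasConst]; norm_num [mul_assoc])
    rw [h1, h2, one_mul, hval]
  exact gammaHodgeSector_iff.mp h 1 1 0 _ _ _ _ dasConst hadm hadm' hodgeCondition_das isAlgebraic_dasConst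
    r r' hr hr' hv

open Summit.KontsevichZagierPeriods.KontsevichZagierPeriods.Theses.TerasomaMultiplication (DasGapTwelve) in
/-- **The Γ-Hodge sector contains `DasGapTwelve` (stmt-KontsevichZagierPeriods-13215), unconditionally**:
`GammaHodgeSector → DasGapTwelve` (the value identity is `beta_das`). Positive glue — evidence
for provers, not landed by the refuter. [folklore] -/
theorem dasGapTwelve_of_gammaHodgeSector' (h : GammaHodgeSector) : DasGapTwelve :=
  dasGapTwelve_of_gammaHodgeSector h beta_das

end DasGap


/-! ## §8 TARGETS A — line `koblitz-ogus-halving`: `stub_positiveRoot` is cancellation strength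

The skeleton registered 2026-08-16T02:09Z (stubs `stub_hodgeLattice`, `stub_betaSyzygy`, `stub_ballDisc`,
`stub_powerFromLattice`, `stub_positiveRoot`) routes the sector through ROOT EXTRACTION BY POSITIVITY in
`FormalRep ⧸ relations`. Its hardest stub, verbatim (`StubPositiveRoot`), is summit-implied (no kill
short of `¬` summit) and already at `n = 0` it is REGULAR CANCELLATION, hence implies this route's
open crux `BetaCancellation` (13633) and the open `KZ.PiCancellation` (0540):
`PiCancellation ∧ BetaCancellation ≤ stub_positiveRoot ≤ summit`. The remaining stubs are
summit-implied (value hypotheses / equal values, see the header) or the proved Koblitz–Ogus theorem.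
(Landed copy: `Negative/StubPositiveRoot.lean`.) -/

section TargetsA

open Summit.KontsevichZagierPeriods.KontsevichZagierPeriods.BetaCancellationNegative
  (KernelCancellation IsPinned betaKernel isPinned_prod betaCancellation_iff
    integrableOn_betaKernel_and_integral_eq integral_betaKernel_pos pinDomain pinFun mem_unitIoo)
open Literature.NumberTheory.Transcendental.KZreg (unitIoo isSemialgebraic_unitIoo)
open Summit.KontsevichZagierPeriods.KontsevichZagierPeriods.Theses.TerasomaMultiplication
  (BetaCancellation)

open Summit.KontsevichZagierPeriods.KontsevichZagierPeriods.BetaCancellationNegative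
  (KernelCancellation IsPinned betaKernel isPinned_prod betaCancellation_iff
    integrableOn_betaKernel_and_integral_eq integral_betaKernel_pos pinDomain pinFun mem_unitIoo)
open Literature.NumberTheory.Transcendental.KZreg (unitIoo isSemialgebraic_unitIoo)
open Summit.KontsevichZagierPeriods.KontsevichZagierPeriods.Theses.TerasomaMultiplication
  (BetaCancellation)

/-! ## The stub, verbatim -/

/-- `stub_positiveRoot` of line `koblitz-ogus-halving` (registered signature, verbatim): root
extraction by positivity in the formal period ring — if `x^{n+1} κ ≡ y^{n+1} κ` modulo the moves,
`eval x, eval y > 0` and `eval κ ≠ 0`, then `x ≡ y` (a stub under analysis: negative knowledge about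
the crux, not a citable proposition). -/
def StubPositiveRoot : Prop :=
  ∀ (n : ℕ) (x y κ : FormalRep), (fun e => x * e)^[n + 1] κ - (fun e => y * e)^[n + 1] κ ∈ relations →
    0 < eval x → 0 < eval y → eval κ ≠ 0 → x - y ∈ relations

/-- `eval` of a left-nested power: `eval ((x * ·)^[n] κ) = (eval x)^n · eval κ` (multiplicativity
of `eval`, `KZ.eval_mul'`). [cite: KontsevichZagier2001, §4.1] -/
theorem eval_mul_iterate (x κ : FormalRep) (n : ℕ) :
    eval ((fun e => x * e)^[n] κ) = eval x ^ n * eval κ := by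
  induction n with
  | zero => simp
  | succ n ih => rw [Function.iterate_succ_apply', eval_mul', ih, pow_succ]; ring

/-- The summit in kernel form: `eval c = 0 → c ∈ relations`
(`kzKernelConjecture_iff_isRational`). [cite: KontsevichZagier2001, §1.2 Conjecture 1] -/
theorem kernel_of_summit (h : KontsevichZagierPeriods) : KZKernelConjecture :=
  KZKernelConjecture.of_kzPeriodConjecture' (kzPeriodConjecture'_iff_isRational.mpr h)

/-- **The summit implies `stub_positiveRoot`.** By soundness the hypothesis gives
`(eval x)^{n+1} eval κ = (eval y)^{n+1} eval κ`, so `eval x = eval y` (cancel `eval κ ≠ 0`, then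
injectivity of `t ↦ t^{n+1}` on non-negative reals), and the kernel form of Conjecture 1 puts
`x − y` in `relations`. So the stub cannot be refuted without refuting the summit. [folklore] -/
theorem stubPositiveRoot_of_summit (h : KontsevichZagierPeriods) : StubPositiveRoot := by
  intro n x y κ hrel hx hy hκ
  have h0 : eval ((fun e => x * e)^[n + 1] κ - (fun e => y * e)^[n + 1] κ) = 0 :=
    relations_le_ker_eval_holds hrel
  rw [map_sub, eval_mul_iterate, eval_mul_iterate, sub_eq_zero] at h0
  have h1 : eval x ^ (n + 1) = eval y ^ (n + 1) := mul_right_cancel₀ hκ h0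
  have h2 : eval x = eval y := (pow_left_inj₀ hx.le hy.le (Nat.succ_ne_zero n)).mp h1
  apply kernel_of_summit h
  rw [map_sub, h2, sub_self]

/-! ## Already `n = 0` is regular cancellation -/

/-- REGULAR CANCELLATION in the formal period ring: every formal combination `κ` of non-zero
evaluation is a non-zero-divisor of `FormalRep ⧸ relations` (right factor; by
`KZ.mul_sub_mul_comm_mem_relations` the side does not matter). The general form of the open
cancellation cruxes `KZ.PiCancellation` (stmt-0540) and `BetaCancellation` (stmt-13633); a
statement under analysis (negative knowledge about the crux), not a citable proposition. -/
def RegularCancellation : Prop :=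
  ∀ (κ c : FormalRep), eval κ ≠ 0 → c * κ ∈ relations → c ∈ relations

/-- **`stub_positiveRoot` (at `n = 0`) implies regular cancellation.** Given `c * κ ∈ relations`,
write `c ≡ [r] − [r']` (`KZ.exists_integralRep_sub`) and apply the stub to
`x = [r] + [pt, M]`, `y = [r'] + [pt, M]` with a natural number `M > |value r| + |value r'|`
(so `eval x, eval y > 0`; `x − y = [r] − [r']`). The positivity guards cost nothing. [folklore] -/
theorem regularCancellation_of_stubPositiveRoot (h : StubPositiveRoot) : RegularCancellation := by
  intro κ c hκ hc
  obtain ⟨n, m, r, r', hsub⟩ := exists_integralRep_sub_holds c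
  set M : ℕ := ⌊|r.value|⌋₊ + ⌊|r'.value|⌋₊ + 1 with hM
  have hMr : 0 < r.value + (M : ℝ) := by
    have h1 : |r.value| < ⌊|r.value|⌋₊ + 1 := Nat.lt_floor_add_one _
    have h2 : -r.value ≤ |r.value| := neg_le_abs _
    have h3 : (0:ℝ) ≤ ⌊|r'.value|⌋₊ := Nat.cast_nonneg _
    simp only [hM, Nat.cast_add, Nat.cast_one]
    linarith
  have hMr' : 0 < r'.value + (M : ℝ) := by
    have h1 : |r'.value| < ⌊|r'.value|⌋₊ + 1 := Nat.lt_floor_add_one _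
    have h2 : -r'.value ≤ |r'.value| := neg_le_abs _
    have h3 : (0:ℝ) ≤ ⌊|r.value|⌋₊ := Nat.cast_nonneg _
    simp only [hM, Nat.cast_add, Nat.cast_one]
    linarith
  set x : FormalRep := KZ.of r + KZ.of (constRep (M : ℚ)) with hx
  set y : FormalRep := KZ.of r' + KZ.of (constRep (M : ℚ)) with hy
  have hex : eval x = r.value + (M : ℝ) := by simp [hx, eval_of, constRep_value]
  have hey : eval y = r'.value + (M : ℝ) := by simp [hy, eval_of, constRep_value]
  have hxy : x - y = KZ.of r - KZ.of r' := by simp only [hx, hy]; abel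
  have hd : KZ.of r - KZ.of r' - c ∈ relations := by
    have := relations.neg_mem hsub
    convert this using 1
    abel
  have h1 : (KZ.of r - KZ.of r') * κ - c * κ ∈ relations := by
    rw [← sub_mul]
    exact mul_mem_relations_right_holds _ _ hd
  have h2 : (KZ.of r - KZ.of r') * κ ∈ relations := by
    have := relations.add_mem h1 hc
    simpa using this
  have hhyp : (fun e => x * e)^[0 + 1] κ - (fun e => y * e)^[0 + 1] κ ∈ relations := by
    simp only [zero_add, Function.iterate_one]
    rw [← sub_mul, hxy]
    exact h2
  have hconc := h 0 x y κ hhyp (by rw [hex]; exact hMr) (by rw [hey]; exact hMr') hκ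
  rw [hxy] at hconc
  have := relations.add_mem hconc (relations.neg_mem hd)
  convert this using 1
  abel

/-- Conversely regular cancellation is the case `n = 0` of the stub (without positivity). [folklore] -/
theorem stubPositiveRoot_zero_of_regularCancellation (h : RegularCancellation) (x y κ : FormalRep)
    (hrel : (fun e => x * e)^[0 + 1] κ - (fun e => y * e)^[0 + 1] κ ∈ relations) (hκ : eval κ ≠ 0) :
    x - y ∈ relations := by
  simp only [zero_add, Function.iterate_one] at hrel
  rw [← sub_mul] at hrel
  exact h κ _ hκ hrel

/-! ## Regular cancellation implies the two open cancellation cruxes -/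

/-- **Regular cancellation ⇒ `KZ.PiCancellation`** (stmt-KontsevichZagierPeriods-0540):
`[π] * c ∈ relations ⇒ c * [π] ∈ relations` (commutativity modulo relations) and `eval [π] = π ≠ 0`.
[folklore] -/
theorem piCancellation_of_regularCancellation (h : RegularCancellation) : PiCancellation := by
  intro c hc
  exact h (KZ.of piRep) c (by rw [eval_of_piRep]; exact Real.pi_ne_zero) (mul_mem_relations_of_left hc)

/-- **Regular cancellation ⇒ cancellation by any REALISED kernel of non-zero integral**: if some
representation `κ = [(0,1), k]` exists with `value κ ≠ 0` then `KernelCancellation k`. A pinned `q`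
over `r` is congruent to `κ × r` (same domain, integrands agree on it:
`KZ.of_sub_of_mem_relations_of_eqOn`), so `q ∼ q'` gives `[κ]·([r] − [r']) ∈ relations`, hence
`([r] − [r'])·[κ] ∈ relations`, and regular cancellation finishes. [folklore] -/
theorem kernelCancellation_of_regularCancellation (h : RegularCancellation) {k : ℝ → ℝ}
    (κ : IntegralRep 1) (hκd : κ.domain = unitIoo) (hκi : ∀ x ∈ unitIoo, κ.integrand x = k (x 0))
    (hκv : κ.value ≠ 0) : KernelCancellation k := by
  intro n m r r' q q' hq hq' hqq'
  -- `q ≡ κ × r`, `q' ≡ κ × r'`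
  have hpr := isPinned_prod κ hκd hκi r
  have hpr' := isPinned_prod κ hκd hκi r'
  have hc : KZ.of q - KZ.of (κ.prod r) ∈ relations :=
    of_sub_of_mem_relations_of_eqOn (by rw [hpr.1, hq.1]) fun z hz => by
      rw [hq.2 hz, hpr.2 (by rw [hpr.1, ← hq.1]; exact hz)]
  have hc' : KZ.of q' - KZ.of (κ.prod r') ∈ relations :=
    of_sub_of_mem_relations_of_eqOn (by rw [hpr'.1, hq'.1]) fun z hz => by
      rw [hq'.2 hz, hpr'.2 (by rw [hpr'.1, ← hq'.1]; exact hz)]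
  have h1 : KZ.of (κ.prod r) - KZ.of (κ.prod r') ∈ relations := by
    have := relations.sub_mem (relations.sub_mem hqq' hc) (relations.neg_mem hc')
    convert this using 1
    abel
  rw [← of_mul_of, ← of_mul_of, ← mul_sub] at h1
  have h2 : (KZ.of r - KZ.of r') * KZ.of κ ∈ relations := mul_mem_relations_of_left h1
  exact h (KZ.of κ) _ (by rwa [eval_of]) h2

/-! ### The Beta representation `[(0,1), t^{a-1}(1-t)^{b-1}]` for positive rationals -/

/-- Transport of integrability between `S ⊆ ℝ` and `{x | x 0 ∈ S} ⊆ ℝ¹` (copy of the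
BetaCancellation disprover's lemma, to keep imports small). [folklore] -/
theorem integrableOn_comp_apply_zero_iff' {g : ℝ → ℝ} {S : Set ℝ} :
    IntegrableOn (fun x : Fin 1 → ℝ => g (x 0)) {x | x 0 ∈ S} ↔ IntegrableOn g S :=
  (volume_preserving_funUnique (Fin 1) ℝ).integrableOn_comp_preimage
    (MeasurableEquiv.funUnique (Fin 1) ℝ).measurableEmbedding

/-- The Beta kernel as an Euler–Mellin integrand: family `(X₀, 1 − X₀)`, exponents `(a−1, b−1)`,
constant `1`. [folklore] -/
theorem betaKernel_eq_mellinIntegrand (a b : ℚ) (x : Fin 1 → ℝ) :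
    betaKernel a b (x 0) =
      mellinIntegrand ![(MvPolynomial.X 0 : MvPolynomial (Fin 1) ℚ), 1 - MvPolynomial.X 0]
        ![a - 1, b - 1] 1 x := by
  simp [mellinIntegrand, betaKernel, Fin.prod_univ_two]

/-- **The Beta representation** `betaRep a b = [(0,1), t^{a−1}(1−t)^{b−1}]` for rationals
`a, b > 0` (semialgebraic integrand by `KZ.isSemialgebraicFunOn_mellinIntegrand` — rational
exponents, no Tarski–Seidenberg; integrable by Mathlib's Beta density). [cite: KontsevichZagier2001, §1.1] -/
def betaRep (a b : ℚ) (ha : 0 < a) (hb : 0 < b) : IntegralRep 1 where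
  domain := unitIoo
  integrand := fun x => betaKernel a b (x 0)
  isSemialgebraic_domain := isSemialgebraic_unitIoo
  isSemialgebraicFunOn_integrand := by
    refine (isSemialgebraicFunOn_mellinIntegrand isSemialgebraic_unitIoo
      ![(MvPolynomial.X 0 : MvPolynomial (Fin 1) ℚ), 1 - MvPolynomial.X 0] ![a - 1, b - 1] 1
      (fun x hx k => ?_)).congr fun x _ => (betaKernel_eq_mellinIntegrand a b x).symm
    rw [mem_unitIoo] at hx
    fin_cases k
    · simpa using hx.1
    · simpa [sub_pos] using hx.2
  integrableOn := by
    have h := (integrableOn_betaKernel_and_integral_eq ha hb).1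
    have : unitIoo = {x : Fin 1 → ℝ | x 0 ∈ Ioo (0:ℝ) 1} := by ext x; simp
    rw [this]
    exact integrableOn_comp_apply_zero_iff'.2 h

/-- `value (betaRep a b) = ∫₀¹ t^{a−1}(1−t)^{b−1} dt` (`= B(a,b)`). [folklore] -/
theorem betaRep_value (a b : ℚ) (ha : 0 < a) (hb : 0 < b) :
    (betaRep a b ha hb).value = ∫ t in Ioo (0:ℝ) 1, betaKernel a b t := by
  have hdom : (betaRep a b ha hb).domain = (MeasurableEquiv.funUnique (Fin 1) ℝ) ⁻¹' Ioo 0 1 := by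
    ext t; simp [betaRep, MeasurableEquiv.funUnique]
  rw [IntegralRep.value, hdom]
  exact (volume_preserving_funUnique (Fin 1) ℝ).setIntegral_preimage_emb
    (MeasurableEquiv.measurableEmbedding _) (betaKernel a b) (Ioo 0 1)

/-- `value (betaRep a b) ≠ 0` (it is `B(a,b) > 0`). [folklore] -/
theorem betaRep_value_ne_zero (a b : ℚ) (ha : 0 < a) (hb : 0 < b) :
    (betaRep a b ha hb).value ≠ 0 := by
  rw [betaRep_value]
  exact (integral_betaKernel_pos ha hb).ne'

/-- **Regular cancellation ⇒ `BetaCancellation`** (stmt-KontsevichZagierPeriods-13633, this route's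
rank-4 crux). [folklore] -/
theorem betaCancellation_of_regularCancellation (h : RegularCancellation) : BetaCancellation :=
  betaCancellation_iff.2 fun a b ha hb =>
    kernelCancellation_of_regularCancellation h (betaRep a b ha hb) rfl (fun _ _ => rfl)
      (betaRep_value_ne_zero a b ha hb)

/-! ## Summary for the lead -/

/-- **`stub_positiveRoot ⇒ BetaCancellation`**: the line's hardest stub contains this route's
OPEN crux stmt-13633. [folklore] -/
theorem betaCancellation_of_stubPositiveRoot (h : StubPositiveRoot) : BetaCancellation :=
  betaCancellation_of_regularCancellation (regularCancellation_of_stubPositiveRoot h)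

/-- **`stub_positiveRoot ⇒ KZ.PiCancellation`**: the line's hardest stub contains the OPEN
`π`-cancellation crux stmt-0540 of route AyoubSpecialisation. [folklore] -/
theorem piCancellation_of_stubPositiveRoot (h : StubPositiveRoot) : PiCancellation :=
  piCancellation_of_regularCancellation (regularCancellation_of_stubPositiveRoot h)

/-- The sandwich `PiCancellation ∧ BetaCancellation ≤ stub_positiveRoot ≤ summit`, in one line.
[folklore] -/
theorem stubPositiveRoot_sandwich :
    (KontsevichZagierPeriods → StubPositiveRoot) ∧
      (StubPositiveRoot → BetaCancellation ∧ PiCancellation) :=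
  ⟨stubPositiveRoot_of_summit, fun h => ⟨betaCancellation_of_stubPositiveRoot h,
    piCancellation_of_stubPositiveRoot h⟩⟩


/-! ## The stub's own hypotheses are tight -/

/-- `stub_positiveRoot` WITHOUT the positivity guards `0 < eval x`, `0 < eval y` (statement under
analysis, not a citable proposition). -/
def StubRootWithoutPositivity : Prop :=
  ∀ (n : ℕ) (x y κ : FormalRep), (fun e => x * e)^[n + 1] κ - (fun e => y * e)^[n + 1] κ ∈ relations →
    eval κ ≠ 0 → x - y ∈ relations

/-- **The positivity guards of `stub_positiveRoot` are load-bearing** (for even exponents): with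
`n = 1`, `x = [π]`, `y = −[π]`, `κ = [pt, 1]` one has `x(xκ) − y(yκ) = 0 ∈ relations` and
`eval κ = 1`, but `x − y = 2[π] ∉ relations` (`eval = 2π ≠ 0`, soundness). So root extraction in the
formal period ring genuinely needs the sign information; any proof of the stub must use it. [folklore] -/
theorem stubRoot_false_without_positivity : ¬ StubRootWithoutPositivity := by
  intro h
  have hκ : eval (KZ.of (constRep 1)) ≠ 0 := by
    rw [eval_of, constRep_value]; norm_num
  have hhyp : (fun e => KZ.of piRep * e)^[1 + 1] (KZ.of (constRep 1)) -
      (fun e => (-KZ.of piRep) * e)^[1 + 1] (KZ.of (constRep 1)) ∈ relations := by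
    simp only [Function.iterate_succ_apply', Function.iterate_zero_apply, neg_mul, mul_neg, neg_neg,
      sub_self]
    exact relations.zero_mem
  have hconc := h 1 (KZ.of piRep) (-KZ.of piRep) (KZ.of (constRep 1)) hhyp hκ
  have h0 : eval (KZ.of piRep - -KZ.of piRep) = 0 := relations_le_ker_eval_holds hconc
  rw [sub_neg_eq_add, map_add, eval_of_piRep] at h0
  linarith [Real.pi_pos]

/-- `stub_positiveRoot` WITHOUT `eval κ ≠ 0` (statement under analysis). -/
def StubRootWithoutRegular : Prop :=
  ∀ (n : ℕ) (x y κ : FormalRep), (fun e => x * e)^[n + 1] κ - (fun e => y * e)^[n + 1] κ ∈ relations →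
    0 < eval x → 0 < eval y → x - y ∈ relations

/-- **`eval κ ≠ 0` is load-bearing**: `κ = 0` makes the hypothesis trivial (`x·0 − y·0 = 0`) while
`x = [pt, 1] ≁ [pt, 2] = y`. [folklore] -/
theorem stubRoot_false_without_regular : ¬ StubRootWithoutRegular := by
  intro h
  have hx : 0 < eval (KZ.of (constRep 1)) := by rw [eval_of, constRep_value]; norm_num
  have hy : 0 < eval (KZ.of (constRep 2)) := by rw [eval_of, constRep_value]; norm_num
  have hhyp : (fun e => KZ.of (constRep 1) * e)^[0 + 1] (0 : FormalRep) -
      (fun e => KZ.of (constRep 2) * e)^[0 + 1] (0 : FormalRep) ∈ relations := by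
    simp only [zero_add, Function.iterate_one, mul_zero, sub_self]
    exact relations.zero_mem
  have hconc := h 0 _ _ 0 hhyp hx hy
  have h0 : eval (KZ.of (constRep 1) - KZ.of (constRep 2)) = 0 := relations_le_ker_eval_holds hconc
  rw [map_sub, eval_of, eval_of, constRep_value, constRep_value] at h0
  norm_num at h0


end TargetsA


/-! ## §9 TARGETS B — line `schwarz-cusp-transport` (the ACTIVE registration, 02:20Z)

Classification of its seven stubs (signatures from `ledger workitem stubs`; the skeleton-local
`CuspDatum`, `IsBetaRep`, `AccessiblePair`, `classVec`, `standardSpan`, `pairSpan`, `schwarzPairs` are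
not readable on this box, so statements about them are modulo the natural reading):
* `stub_latticeRealisation`, `stub_residualBeyondSchwarz`: conclusion `Equivalent r r'` under
  `r.value = r'.value` with crux-shaped pinnings ⇒ instances of `KZPeriodConjecture'` ⇒ summit-implied
  (`core_of_summit`); `stub_residualBeyondSchwarz` IS the crux on data with a prime `p > 5` in a
  denominator (the depth-4 instances of §7, `hodgeCondition_deep33/35`, live there): the line's honest
  remainder, as hard as the crux on that sub-family. Not killable.
* `stub_cuspRelation`: `[s₁] + [s₂] + [s₃] ∈ relations` forces (soundness) the three-term VALUE identity
  `(1−c)B(a,c−a) + e·B_c·B(a,e) + b·A·B(c−a,1−e) = 0`; with Kummer's connection constants it reduces to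
  the trigonometric identity `cusp_trig_identity` below, PROVED for all real `a, b, c` — so the value
  side never fails and the stub is summit-implied PROVIDED `CuspDatum a b c` pins `d.A`, `d.B` to the
  Kummer constants; should the structure leave them free (any algebraic reals), the stub is FALSE by
  soundness (`Equivalent.value_eq`) — lead: check the fields of `CuspDatum`.
* `stub_schwarzWitnesses` (`Nonempty (CuspDatum …)` at the tetrahedral/icosahedral triples): a
  construction, attackable only through the definition.
* `stub_threeTermToPair`: linear algebra in `FormalRep ⧸ relations` (two-sided ideal, §8 tools) once
  `AccessiblePair` is unfolded; degenerate `κ₂ = κ₃ = 0` makes its relation-hypothesis false (not the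
  stub). Not attackable without the definition.
* `stub_cornerChains`: three linear pairs claimed accessible from Multiplication + Reflection +
  BetaCancellation. Each pair IS Hodge type (`hodgeCondition_corner12/15/20`, `decide`), hence a crux
  instance (summit-implied); whether its class lies in the STANDARD span `S_N` (so that the three named
  items can suffice) is decided by the lattice job below (`cornerN_inS`).
* `stub_smoothLatticeGeneration`: pure arithmetic, decidable per level, claimed for ALL 5-smooth levels
  and verified by the planner for `D ≤ 360` — the one genuinely falsifiable stub. Compute job
  `compute/smooth_gap.gp` (PARI; ids and results recorded in the docstring of `smoothLattice_job_record`
  below as they arrive): for every 5-smooth `D` it recomputes the gap `Sat(S_D)/S_D` (= `H_D/S_D`, rank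
  equality checked), its Smith invariants, and the index after adjoining (W) the level-lifted Schwarz
  classes `v12, v15, v20` and (T) all their unit twists. A level with `W_index > 1` (resp. `T_index > 1`)
  falsifies the stub in the plain (resp. twisted) reading of `pairSpan`. -/

section TargetsB

/-- **The value identity behind `stub_cuspRelation` never fails**: for all real `a, b, c`, with
`e = c − a − b`, `sin(πc)·sin(πe) = sin(π(c−a))·sin(π(c−b)) − sin(πa)·sin(πb)` (the card's reduction of
the three-term cusp relation; here a one-line polynomial identity in `sin, cos` of `πa, πb, πc`). [folklore] -/
theorem cusp_trig_identity (a b c : ℝ) :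
    Real.sin (Real.pi * c) * Real.sin (Real.pi * (c - a - b)) =
      Real.sin (Real.pi * (c - a)) * Real.sin (Real.pi * (c - b)) - Real.sin (Real.pi * a) * Real.sin (Real.pi * b) := by
  have h1 : Real.pi * (c - a - b) = (Real.pi * c - Real.pi * a) - Real.pi * b := by ring
  have h2 : Real.pi * (c - a) = Real.pi * c - Real.pi * a := by ring
  have h3 : Real.pi * (c - b) = Real.pi * c - Real.pi * b := by ring
  rw [h1, h2, h3]
  simp only [Real.sin_sub, Real.cos_sub]
  linear_combination (-(Real.sin (Real.pi * a) * Real.sin (Real.pi * b))) * Real.sin_sq_add_cos_sq (Real.pi * c)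

/-- The corner pair of `stub_cornerChains` at level 12, `B(1/4,2/3)` versus `B(1/4,1/3)`, is of Hodge
type with `k = 0` (so `[B(1/4,2/3)] ∼ [c·B(1/4,1/3)]` for the right algebraic `c` is an instance of the
crux, summit-implied). [folklore] -/
theorem hodgeCondition_corner12 : HodgeCondition 1 1 0 ![1 / 4] ![2 / 3] ![1 / 4] ![1 / 3] := by
  rw [hodgeCondition_iff_le (D := 12) (by norm_num) (by decide +kernel) (by decide +kernel)
    (by decide +kernel) (by decide +kernel) (by decide +kernel) (by decide +kernel)]
  decide +kernel

/-- The corner pair at level 15, `B(4/15,3/5)` versus `B(1/15,2/5)`, is of Hodge type (`k = 0`). [folklore] -/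
theorem hodgeCondition_corner15 : HodgeCondition 1 1 0 ![4 / 15] ![3 / 5] ![1 / 15] ![2 / 5] := by
  rw [hodgeCondition_iff_le (D := 15) (by norm_num) (by decide +kernel) (by decide +kernel)
    (by decide +kernel) (by decide +kernel) (by decide +kernel) (by decide +kernel)]
  decide +kernel

/-- The corner pair at level 20, `B(7/20,3/5)` versus `B(3/20,2/5)`, is of Hodge type (`k = 0`). [folklore] -/
theorem hodgeCondition_corner20 : HodgeCondition 1 1 0 ![7 / 20] ![3 / 5] ![3 / 20] ![2 / 5] := by
  rw [hodgeCondition_iff_le (D := 20) (by norm_num) (by decide +kernel) (by decide +kernel)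
    (by decide +kernel) (by decide +kernel) (by decide +kernel) (by decide +kernel)]
  decide +kernel

/-- RECORD of the lattice attack on `stub_smoothLatticeGeneration` (kit jobs `j011104`/`j011505` smoke
tests `D ≤ 60`; full run to follow; this docstring is updated with the verdict lines
`D=… gap=… W_index=… T_index=… verdict=…` as they arrive). [folklore] -/
theorem smoothLattice_job_record : True := trivial

end TargetsB


/-! ## §10 The first instance of the crux is a THEOREM (tightness at the bottom rung)

Composing gen 1's §5 with the BetaCancellation disprover's landed four-move chain
`BetaCancellationNegative.equivalent_betaHalfRep_piRep : [β(½,½)] ∼ [π]`: `arcsineRep ∼ discRep`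
unconditionally, and the instance `(1,0,1), x = y = ½` of the crux holds for EVERY `c, r, r'`.
(Landed copy: `Negative/FirstInstance.lean`.) -/

section FirstInstance

open Summit.KontsevichZagierPeriods.KontsevichZagierPeriods.BetaCancellationNegative
  (betaHalfRep betaKernel equivalent_betaHalfRep_piRep mem_unitIoo)
open Literature.NumberTheory.Transcendental.KZreg (unitIoo)

open Summit.KontsevichZagierPeriods.KontsevichZagierPeriods.BetaCancellationNegative
  (betaHalfRep betaKernel equivalent_betaHalfRep_piRep mem_unitIoo)
open Literature.NumberTheory.Transcendental.KZreg (unitIoo)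

/-- `arcsineRep` and `betaHalfRep` have the same domain `(0,1) ⊆ ℝ¹` (two spellings). [folklore] -/
theorem betaHalfRep_domain_eq_arcsineRep_domain : betaHalfRep.domain = arcsineRep.domain := by
  ext t
  change t ∈ unitIoo ↔ t ∈ unitIntervalDomain
  rw [mem_unitIoo, mem_unitIntervalDomain]

/-- … and integrands agreeing on it (`t^{−1/2}(1−t)^{−1/2}`). [folklore] -/
theorem arcsineRep_integrand_eqOn :
    EqOn arcsineRep.integrand betaHalfRep.integrand arcsineRep.domain := by
  intro t _
  change arcsineFun t = betaKernel (1/2) (1/2) (t 0)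
  simp only [arcsineFun, betaKernel]
  push_cast
  norm_num

/-- `arcsineRep ∼ betaHalfRep` (congruence: same domain, same integrand on it). [folklore] -/
theorem equivalent_arcsineRep_betaHalfRep : Equivalent arcsineRep betaHalfRep :=
  of_sub_of_mem_relations_of_eqOn betaHalfRep_domain_eq_arcsineRep_domain arcsineRep_integrand_eqOn

/-- **`arcsineRep ∼ discRep`, unconditionally**: `[(0,1), t^{−1/2}(1−t)^{−1/2}] ∼ [open unit disc, 1]`
(congruence, the four-move chain `[β(½,½)] ∼ [π]` of `BetaCancellationNegative`, and the
null-circle move `[closed disc] ∼ [open disc]`). Gen 1's "first prover target" is closed.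
[cite: KontsevichZagier2001, §1.1] -/
theorem equivalent_arcsineRep_discRep : Equivalent arcsineRep discRep :=
  (equivalent_arcsineRep_betaHalfRep.trans equivalent_betaHalfRep_piRep).trans equivalent_piRep_discRep

/-- A representation pinned as the cube representation at `N = 1`, `x = y = ½` is congruent to
`arcsineRep`. [folklore] -/
theorem equivalent_of_isCubeBetaRep_half {r : IntegralRep 1}
    (hr : IsCubeBetaRep (fun _ : Fin 1 => (1 / 2 : ℚ)) (fun _ => 1 / 2) r) :
    Equivalent r arcsineRep := by
  refine of_sub_of_mem_relations_of_eqOn ?_ fun t ht => ?_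
  · rw [hr.1]; rfl
  · rw [hr.2 ht]
    change _ = arcsineFun t
    simp only [arcsineFun, Fin.prod_univ_one]
    push_cast
    norm_num

/-- A representation pinned as `[unit 2-ball × (0,1)^0, c · 1! · 1]` is congruent to `[unit disc, c]`.
[folklore] -/
theorem equivalent_of_isBallCubeRep_one {c : ℝ} {r' : IntegralRep (2 * 1 + 0)}
    (hr' : IsBallCubeRep (N' := 0) 1 Fin.elim0 Fin.elim0 c r') :
    Equivalent r' (constDiscRep c (isAlgebraic_of_isBallCubeRep hr')) := by
  refine of_sub_of_mem_relations_of_eqOn ?_ fun z hz => ?_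
  · rw [hr'.1]
    ext z
    simp [constDiscRep, unitDisc, Fin.sum_univ_two]
  · rw [hr'.2 hz]
    simp [constDiscRep]

/-- **The first instance of the crux is a theorem.** For `(N, N', k) = (1, 0, 1)`, `x = y = ½`: for
every real `c` and all representations `r`, `r'` pinned as in `GammaHodgeSector` with
`value r = value r'`, `r ∼ r'` — unconditionally (value equality forces `c = 1`; then
`r ∼ arcsineRep ∼ discRep ∼ r'`). The admissibility / Hodge-type / algebraicity hypotheses of the
crux are not even needed here. [cite: KontsevichZagier2001, §1.1] -/
theorem gammaHodgeSector_instance_half (c : ℝ) (r : IntegralRep 1) (r' : IntegralRep (2 * 1 + 0))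
    (hr : IsCubeBetaRep (fun _ : Fin 1 => (1 / 2 : ℚ)) (fun _ => 1 / 2) r)
    (hr' : IsBallCubeRep (N' := 0) 1 Fin.elim0 Fin.elim0 c r') (hv : r.value = r'.value) :
    Equivalent r r' := by
  have hc : IsAlgebraic ℚ c := isAlgebraic_of_isBallCubeRep hr'
  have h1 : Equivalent r arcsineRep := equivalent_of_isCubeBetaRep_half hr
  have h2 : Equivalent r' (constDiscRep c hc) := equivalent_of_isBallCubeRep_one hr'
  -- value equality forces `c = 1`
  have hvr : r.value = Real.pi := by rw [Equivalent.value_eq_holds h1, arcsineRep_value]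
  have hvr' : r'.value = Real.pi * c := by rw [Equivalent.value_eq_holds h2, constDiscRep_value]
  have hc1 : c = 1 := by
    have : Real.pi * c = Real.pi * 1 := by rw [mul_one, ← hvr', ← hv, hvr]
    exact mul_left_cancel₀ Real.pi_ne_zero this
  -- `[unit disc, 1] ∼ discRep` (literally the same data)
  have h3 : Equivalent (constDiscRep c hc) discRep :=
    of_sub_of_mem_relations_of_eqOn rfl fun z _ => by simp [constDiscRep, discRep, hc1]
  exact (h1.trans equivalent_arcsineRep_discRep).trans ((h2.trans h3).symm)


end FirstInstance


/-! ## §11 Canonical representations, the value formulas, the exact non-vacuity criterion and the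
canonical form of the crux

(Landed copy: `Negative/Canonical.lean`.) -/

section Canonical

open Literature.ModelTheory.ExponentialFields (isSemialgebraic_setOf_eval_pos)


/-! ## The unit `2k`-ball representation `[B^{2k}, C]` and its value `C · π^k / k!` -/

/-- The open unit ball `{Σ w_i² < 1} ⊆ ℝⁿ` (Euclidean, in the product coordinates). [folklore] -/
def unitBall (n : ℕ) : Set (Fin n → ℝ) := {w | ∑ i, w i ^ 2 < 1}

/-- The unit ball is `ℚ`-semialgebraic (`0 < 1 − Σ X_i²`). [folklore] -/
theorem isSemialgebraic_unitBall (n : ℕ) : IsSemialgebraic ℚ (unitBall n) := by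
  have h := isSemialgebraic_setOf_eval_pos (k := ℚ) (R := ℝ)
    (1 - ∑ i : Fin n, MvPolynomial.X i ^ 2 : MvPolynomial (Fin n) ℚ)
  convert h using 1
  ext w
  simp only [unitBall, mem_setOf_eq, map_sub, map_one, map_sum, map_pow, MvPolynomial.aeval_X, sub_pos]

/-- The unit ball is measurable. [folklore] -/
theorem measurableSet_unitBall (n : ℕ) : MeasurableSet (unitBall n) :=
  (isOpen_lt (by fun_prop) continuous_const).measurableSet

/-- **Volume of the unit `2k`-ball** in `ℝ^{2k}`: `π^k / k!` (Mathlib's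
`InnerProductSpace.volume_ball_of_dim_even`, transported along `WithLp.ofLp`). [folklore] -/
theorem volume_unitBall_even (k : ℕ) :
    volume (unitBall (2 * k)) = ENNReal.ofReal (Real.pi ^ k / (k.factorial : ℝ)) := by
  rcases Nat.eq_zero_or_pos k with rfl | hk
  · -- `ℝ⁰`: the ball is the whole one-point space
    change volume (unitBall 0) = _
    have : unitBall 0 = univ := by
      ext w; simp [unitBall]
    rw [this, volume_pi, Measure.pi_of_empty _ (fun i => i.elim0)]
    simp
  · have hpre : (WithLp.ofLp : EuclideanSpace ℝ (Fin (2 * k)) → (Fin (2 * k) → ℝ)) ⁻¹' unitBall (2 * k) =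
        Metric.ball (0 : EuclideanSpace ℝ (Fin (2 * k))) 1 := by
      rw [EuclideanSpace.ball_zero_eq 1 zero_le_one, one_pow]
      ext x
      simp [unitBall]
    have hnt : Nontrivial (EuclideanSpace ℝ (Fin (2 * k))) := by
      have : Nonempty (Fin (2 * k)) := ⟨⟨0, by omega⟩⟩
      infer_instance
    rw [← (PiLp.volume_preserving_ofLp (Fin (2 * k))).measure_preimage
      (measurableSet_unitBall _).nullMeasurableSet, hpre,
      InnerProductSpace.volume_ball_of_dim_even (k := k) (by simp) (0 : EuclideanSpace ℝ (Fin (2 * k))) 1]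
    simp

/-- The unit-ball representation `[B^{2k}, C]` with an algebraic constant `C`. [folklore] -/
def ballRep (k : ℕ) (C : ℝ) (hC : IsAlgebraic ℚ C) : IntegralRep (2 * k) where
  domain := unitBall (2 * k)
  integrand := fun _ => C
  isSemialgebraic_domain := isSemialgebraic_unitBall _
  isSemialgebraicFunOn_integrand := isSemialgebraicFunOn_const_of_isAlgebraic (isSemialgebraic_unitBall _) hC
  integrableOn := integrableOn_const (by simp [volume_unitBall_even])

/-- `value [B^{2k}, C] = C · π^k / k!`. [folklore] -/
theorem ballRep_value (k : ℕ) (C : ℝ) (hC : IsAlgebraic ℚ C) :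
    (ballRep k C hC).value = C * (Real.pi ^ k / (k.factorial : ℝ)) := by
  rw [IntegralRep.value, show (ballRep k C hC).domain = unitBall (2 * k) from rfl,
    show (ballRep k C hC).integrand = fun _ => C from rfl, setIntegral_const, measureReal_def,
    volume_unitBall_even, ENNReal.toReal_ofReal (by positivity), smul_eq_mul, mul_comm]

/-! ## The cube Beta representation `[(0,1)^N, Π t_j^{x_j−1}(1−t_j)^{y_j−1}]` and its value `Π B(x_j,y_j)` -/

/-- The open unit cube `(0,1)^N` in the crux's spelling. [folklore] -/
def cubeDom (N : ℕ) : Set (Fin N → ℝ) := {t | ∀ j, t j ∈ Ioo (0:ℝ) 1}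

/-- The cube is the product set `Π (0,1)`. [folklore] -/
theorem cubeDom_eq_pi (N : ℕ) : cubeDom N = Set.pi univ fun _ => Ioo (0:ℝ) 1 := by
  ext t; simp [cubeDom]

/-- The Beta product integrand of the crux. [folklore] -/
def cubeFun {N : ℕ} (x y : Fin N → ℚ) : (Fin N → ℝ) → ℝ :=
  fun t => ∏ j, (t j) ^ ((x j : ℝ) - 1) * (1 - t j) ^ ((y j : ℝ) - 1)

/-- The Beta product integrand is an Euler–Mellin integrand: family `(X_j)_j ++ (1 − X_j)_j`,
exponents `(x_j − 1)_j ++ (y_j − 1)_j`, constant `1`. [folklore] -/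
theorem cubeFun_eq_mellinIntegrand {N : ℕ} (x y : Fin N → ℚ) (t : Fin N → ℝ) :
    cubeFun x y t =
      mellinIntegrand (Fin.append (fun j => (MvPolynomial.X j : MvPolynomial (Fin N) ℚ))
          (fun j => 1 - MvPolynomial.X j))
        (Fin.append (fun j => x j - 1) (fun j => y j - 1)) 1 t := by
  simp only [cubeFun, mellinIntegrand, Rat.cast_one, one_mul, Fin.prod_univ_add, Fin.append_left,
    Fin.append_right, MvPolynomial.aeval_X, map_sub, map_one, Rat.cast_sub, Rat.cast_one,
    ← Finset.prod_mul_distrib]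

/-- **The cube Beta representation** `cubeRep x y = [(0,1)^N, Π_j t_j^{x_j−1}(1−t_j)^{y_j−1}]` for
positive rational exponents (the crux's `r`, canonically). [cite: KontsevichZagier2001, §1.1] -/
def cubeRep {N : ℕ} (x y : Fin N → ℚ) (hpos : ∀ j, 0 < x j ∧ 0 < y j) : IntegralRep N where
  domain := cubeDom N
  integrand := cubeFun x y
  isSemialgebraic_domain := isSemialgebraic_box N
  isSemialgebraicFunOn_integrand := by
    refine (isSemialgebraicFunOn_mellinIntegrand (isSemialgebraic_box N) _ _ 1
      (fun t ht k => ?_)).congr fun t _ => (cubeFun_eq_mellinIntegrand x y t).symm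
    refine Fin.addCases (fun i => ?_) (fun i => ?_) k
    · rw [Fin.append_left]
      simpa using (ht i).1
    · rw [Fin.append_right]
      simpa [sub_pos] using (ht i).2
  integrableOn := by
    have h : ∀ j : Fin N, Integrable (fun s : ℝ => s ^ ((x j : ℝ) - 1) * (1 - s) ^ ((y j : ℝ) - 1))
        ((volume : Measure ℝ).restrict (Ioo 0 1)) := fun j =>
      (integrableOn_betaIntegrand_and_integral_eq (by exact_mod_cast (hpos j).1)
        (by exact_mod_cast (hpos j).2)).1
    have hprod := Integrable.fintype_prod (ι := Fin N) (μ := fun _ => (volume : Measure ℝ).restrict (Ioo 0 1)) h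
    rw [IntegrableOn, show cubeDom N = Set.pi univ fun _ => Ioo (0:ℝ) 1 from cubeDom_eq_pi N, volume_pi,
      Measure.restrict_pi_pi]
    exact hprod

/-- **Value of the cube representation**: `value (cubeRep x y) = Π_j B(x_j, y_j)` (Fubini over the
product set and Mathlib's Beta integral). [folklore] -/
theorem cubeRep_value {N : ℕ} (x y : Fin N → ℚ) (hpos : ∀ j, 0 < x j ∧ 0 < y j) :
    (cubeRep x y hpos).value = ∏ j, ProbabilityTheory.beta (x j) (y j) := by
  rw [IntegralRep.value, show (cubeRep x y hpos).domain = cubeDom N from rfl,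
    show (cubeRep x y hpos).integrand = cubeFun x y from rfl, cubeDom_eq_pi, volume_pi,
    Measure.restrict_pi_pi]
  unfold cubeFun
  rw [integral_fintype_prod_eq_prod (fun j (s : ℝ) => s ^ ((x j : ℝ) - 1) * (1 - s) ^ ((y j : ℝ) - 1))]
  refine Finset.prod_congr rfl fun j _ => ?_
  exact (integrableOn_betaIntegrand_and_integral_eq (by exact_mod_cast (hpos j).1)
    (by exact_mod_cast (hpos j).2)).2

/-- A representation pinned as the crux's cube representation IS `cubeRep` up to congruence
(same domain, integrands agree on it). [folklore] -/
theorem equivalent_cubeRep_of_isCubeBetaRep {N : ℕ} {x y : Fin N → ℚ} (hpos : ∀ j, 0 < x j ∧ 0 < y j)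
    {r : IntegralRep N} (hr : IsCubeBetaRep x y r) : Equivalent r (cubeRep x y hpos) :=
  of_sub_of_mem_relations_of_eqOn (by rw [hr.1]; rfl) fun t ht => by rw [hr.2 ht]; rfl

/-- **Value of a pinned cube representation**: `value r = Π_j B(x_j, y_j)` (by soundness from the
congruence with `cubeRep`). [folklore] -/
theorem value_of_isCubeBetaRep {N : ℕ} {x y : Fin N → ℚ} (hpos : ∀ j, 0 < x j ∧ 0 < y j)
    {r : IntegralRep N} (hr : IsCubeBetaRep x y r) :
    r.value = ∏ j, ProbabilityTheory.beta (x j) (y j) := by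
  rw [Equivalent.value_eq_holds (equivalent_cubeRep_of_isCubeBetaRep hpos hr), cubeRep_value]

/-! ## The ball × cube representation and its value `c · π^k · Π B(x'_l, y'_l)` -/

/-- `c · k!` is algebraic when `c` is. [folklore] -/
theorem isAlgebraic_mul_factorial {c : ℝ} (hc : IsAlgebraic ℚ c) (k : ℕ) :
    IsAlgebraic ℚ (c * (k.factorial : ℝ)) :=
  hc.mul (isAlgebraic_nat _)

/-- **The canonical ball × cube representation** `[B^{2k}, c·k!] × cubeRep x' y'` (the crux's `r'`,
canonically, via `KZ.IntegralRep.prod`). [cite: KontsevichZagier2001, §4.1] -/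
def ballCubeRep {N' : ℕ} (k : ℕ) (x' y' : Fin N' → ℚ) (c : ℝ) (hc : IsAlgebraic ℚ c)
    (hpos : ∀ l, 0 < x' l ∧ 0 < y' l) : IntegralRep (2 * k + N') :=
  (ballRep k (c * (k.factorial : ℝ)) (isAlgebraic_mul_factorial hc k)).prod (cubeRep x' y' hpos)

/-- **Value of the canonical ball × cube representation**: `c · π^k · Π_l B(x'_l, y'_l)`
(`value_prod` = Fubini, the ball volume `π^k/k!` cancels the `k!`). [folklore] -/
theorem ballCubeRep_value {N' : ℕ} (k : ℕ) (x' y' : Fin N' → ℚ) (c : ℝ) (hc : IsAlgebraic ℚ c)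
    (hpos : ∀ l, 0 < x' l ∧ 0 < y' l) :
    (ballCubeRep k x' y' c hc hpos).value = c * Real.pi ^ k * ∏ l, ProbabilityTheory.beta (x' l) (y' l) := by
  rw [ballCubeRep, IntegralRep.value_prod, ballRep_value, cubeRep_value]
  have hk : (k.factorial : ℝ) ≠ 0 := by exact_mod_cast (Nat.factorial_pos k).ne'
  field_simp

/-- A representation pinned as the crux's `[unit 2k-ball × (0,1)^{N'}, c · k! · Π]` IS `ballCubeRep`
up to congruence (its domain is literally `prodDomain`, its integrand agrees with `prodFun` there).
[folklore] -/
theorem equivalent_ballCubeRep_of_isBallCubeRep {N' k : ℕ} {x' y' : Fin N' → ℚ} {c : ℝ}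
    (hpos : ∀ l, 0 < x' l ∧ 0 < y' l) {r' : IntegralRep (2 * k + N')} (hr' : IsBallCubeRep k x' y' c r') :
    Equivalent r' (ballCubeRep k x' y' c (isAlgebraic_of_isBallCubeRep hr') hpos) := by
  refine of_sub_of_mem_relations_of_eqOn ?_ fun z hz => ?_
  · rw [hr'.1]
    ext z
    simp [ballCubeRep, IntegralRep.prod_domain, IntegralRep.mem_prodDomain, ballRep, cubeRep, unitBall,
      cubeDom]
  · rw [hr'.2 hz, ballCubeRep, IntegralRep.prod_integrand_eq]
    simp [IntegralRep.prodFun, ballRep, cubeRep, cubeFun, mul_assoc]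

/-- **Value of a pinned ball × cube representation**: `value r' = c · π^k · Π_l B(x'_l, y'_l)`. [folklore] -/
theorem value_of_isBallCubeRep {N' k : ℕ} {x' y' : Fin N' → ℚ} {c : ℝ} (hpos : ∀ l, 0 < x' l ∧ 0 < y' l)
    {r' : IntegralRep (2 * k + N')} (hr' : IsBallCubeRep k x' y' c r') :
    r'.value = c * Real.pi ^ k * ∏ l, ProbabilityTheory.beta (x' l) (y' l) := by
  rw [Equivalent.value_eq_holds (equivalent_ballCubeRep_of_isBallCubeRep hpos hr'), ballCubeRep_value]

/-! ## The canonical form of the crux and the exact non-vacuity criterion -/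


/-- Admissible data have positive exponents. [folklore] -/
theorem Admissible.pos {N : ℕ} {x y : Fin N → ℚ} (h : Admissible x y) : ∀ j, 0 < x j ∧ 0 < y j :=
  fun j => ⟨(h j).1, (h j).2.1⟩

/-- THE DELIGNE IDENTITY of the data `(k, x, y, x', y', c)`: `Π_j B(x_j, y_j) = c · π^k · Π_l B(x'_l, y'_l)`
— the real-number identity to which the crux's hypothesis `value r = value r'` is equivalent
(`valueEq_iff_deligneIdentity`); for Hodge-type data it holds with the algebraic Deligne–Koblitz–Ogus
constant (Deligne 1982, Thm 7.18; a statement under analysis, not a citable proposition). -/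
def DeligneIdentity {N N' : ℕ} (k : ℕ) (x y : Fin N → ℚ) (x' y' : Fin N' → ℚ) (c : ℝ) : Prop :=
  ∏ j, ProbabilityTheory.beta (x j) (y j) = c * Real.pi ^ k * ∏ l, ProbabilityTheory.beta (x' l) (y' l)

/-- `cubeRep` is pinned as the crux's cube representation. [folklore] -/
theorem isCubeBetaRep_cubeRep {N : ℕ} (x y : Fin N → ℚ) (hpos : ∀ j, 0 < x j ∧ 0 < y j) :
    IsCubeBetaRep x y (cubeRep x y hpos) :=
  ⟨rfl, fun _ _ => rfl⟩

/-- `ballCubeRep` is pinned as the crux's ball × cube representation. [folklore] -/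
theorem isBallCubeRep_ballCubeRep {N' : ℕ} (k : ℕ) (x' y' : Fin N' → ℚ) (c : ℝ) (hc : IsAlgebraic ℚ c)
    (hpos : ∀ l, 0 < x' l ∧ 0 < y' l) : IsBallCubeRep k x' y' c (ballCubeRep k x' y' c hc hpos) := by
  refine ⟨?_, fun z hz => ?_⟩
  · ext z
    simp [ballCubeRep, IntegralRep.prod_domain, IntegralRep.mem_prodDomain, ballRep, cubeRep, unitBall,
      cubeDom]
  · rw [ballCubeRep, IntegralRep.prod_integrand_eq]
    simp [IntegralRep.prodFun, ballRep, cubeRep, cubeFun, mul_assoc]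

/-- **Value equality ⇔ the Deligne identity**, for pinned representations. [folklore] -/
theorem valueEq_iff_deligneIdentity {N N' k : ℕ} {x y : Fin N → ℚ} {x' y' : Fin N' → ℚ} {c : ℝ}
    (hx : ∀ j, 0 < x j ∧ 0 < y j) (hx' : ∀ l, 0 < x' l ∧ 0 < y' l)
    {r : IntegralRep N} {r' : IntegralRep (2 * k + N')} (hr : IsCubeBetaRep x y r)
    (hr' : IsBallCubeRep k x' y' c r') : r.value = r'.value ↔ DeligneIdentity k x y x' y' c := by
  rw [value_of_isCubeBetaRep hx hr, value_of_isBallCubeRep hx' hr', DeligneIdentity]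

/-- **EXACT NON-VACUITY CRITERION.** For positive exponent data, a real `c` and `k`, representations
`r`, `r'` pinned as in the crux WITH EQUAL VALUES exist if and only if `c` is algebraic and the
Deligne identity `Π B(x,y) = c·π^k·Π B(x',y')` holds. (So each instance of the crux is either vacuous —
wrong `c` — or says exactly `cubeRep x y ∼ ballCubeRep k x' y' c`.) [folklore] -/
theorem exists_pinned_valueEq_iff {N N' : ℕ} (k : ℕ) {x y : Fin N → ℚ} {x' y' : Fin N' → ℚ}
    (hx : ∀ j, 0 < x j ∧ 0 < y j) (hx' : ∀ l, 0 < x' l ∧ 0 < y' l) (c : ℝ) :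
    (∃ (r : IntegralRep N) (r' : IntegralRep (2 * k + N')),
        IsCubeBetaRep x y r ∧ IsBallCubeRep k x' y' c r' ∧ r.value = r'.value) ↔
      IsAlgebraic ℚ c ∧ DeligneIdentity k x y x' y' c := by
  constructor
  · rintro ⟨r, r', hr, hr', hv⟩
    exact ⟨isAlgebraic_of_isBallCubeRep hr', (valueEq_iff_deligneIdentity hx hx' hr hr').mp hv⟩
  · rintro ⟨hc, hD⟩
    exact ⟨cubeRep x y hx, ballCubeRep k x' y' c hc hx', isCubeBetaRep_cubeRep x y hx,
      isBallCubeRep_ballCubeRep k x' y' c hc hx',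
      (valueEq_iff_deligneIdentity hx hx' (isCubeBetaRep_cubeRep x y hx)
        (isBallCubeRep_ballCubeRep k x' y' c hc hx')).mpr hD⟩

/-- **CANONICAL FORM OF THE CRUX.** `GammaHodgeSector` is equivalent to: for all admissible Hodge-type
data, every algebraic `c` satisfying the Deligne identity, `cubeRep x y ∼ ballCubeRep k x' y' c` — ONE
pair of explicit representations per datum (the quantifiers over `r`, `r'` and the value hypothesis
collapse by congruence, `KZ.of_sub_of_mem_relations_of_eqOn`, and the value formulas). [folklore] -/
theorem gammaHodgeSector_iff_canonical :
    GammaHodgeSector ↔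
      ∀ (N N' k : ℕ) (x y : Fin N → ℚ) (x' y' : Fin N' → ℚ) (c : ℝ)
        (hx : Admissible x y) (hx' : Admissible x' y'), HodgeCondition N N' k x y x' y' →
        ∀ hc : IsAlgebraic ℚ c, DeligneIdentity k x y x' y' c →
          Equivalent (cubeRep x y hx.pos) (ballCubeRep k x' y' c hc hx'.pos) := by
  rw [gammaHodgeSector_iff]
  constructor
  · intro h N N' k x y x' y' c hx hx' hH hc hD
    exact h N N' k x y x' y' c hx hx' hH hc _ _ (isCubeBetaRep_cubeRep x y hx.pos)
      (isBallCubeRep_ballCubeRep k x' y' c hc hx'.pos)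
      ((valueEq_iff_deligneIdentity hx.pos hx'.pos (isCubeBetaRep_cubeRep x y hx.pos)
        (isBallCubeRep_ballCubeRep k x' y' c hc hx'.pos)).mpr hD)
  · intro h N N' k x y x' y' c hx hx' hH hc r r' hr hr' hv
    have hD : DeligneIdentity k x y x' y' c := (valueEq_iff_deligneIdentity hx.pos hx'.pos hr hr').mp hv
    have h1 := equivalent_cubeRep_of_isCubeBetaRep hx.pos hr
    have h2 := equivalent_ballCubeRep_of_isBallCubeRep hx'.pos hr'
    exact (h1.trans (h N N' k x y x' y' c hx hx' hH hc hD)).trans h2.symm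

/-- The canonical `r'` factors: `ballCubeRep = [B^{2k}, c·k!] × cubeRep x' y'`, so by the two-sided
ideal property every instance reads `cubeRep x y ∼ [B^{2k}, c·k!] × cubeRep x' y'` — the "ball–disc"
normalisation any line must perform is confined to the factor `[B^{2k}, c·k!]` (value `c·π^k`).
[folklore] -/
theorem ballCubeRep_eq_prod {N' : ℕ} (k : ℕ) (x' y' : Fin N' → ℚ) (c : ℝ) (hc : IsAlgebraic ℚ c)
    (hpos : ∀ l, 0 < x' l ∧ 0 < y' l) :
    KZ.of (ballCubeRep k x' y' c hc hpos) =
      KZ.of (ballRep k (c * (k.factorial : ℝ)) (isAlgebraic_mul_factorial hc k)) * KZ.of (cubeRep x' y' hpos) := by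
  rw [of_mul_of]; rfl


end Canonical

end Summit.KontsevichZagierPeriods.KontsevichZagierPeriods.Cruxes.GammaHodgeSector.Disproof
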